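import Literature.MathematicalPhysics.QuantumFieldTheory.Balaban1983to89.B6Prop22DualHolderMultiLevelBox
import Literature.MathematicalPhysics.QuantumFieldTheory.Balaban1983to89.B6Prop22DualHolderTwoLevelBoxRateUnif

/-!
# `Balaban1983to89.B6Prop22DualHolderMultiLevelBoxRateUnif` — [B6] PROPOSITION 2.2, FIFTH ENTRY OF (2.67)
(`‖ζG′∇^{η*}λ‖_α`) FOR THE GENUINE `k`-LEVEL OPERATOR ON A BOX, WITH THE PRINTED QUANTIFIER ORDER: ONE rate `δ₀`
and ONE pair of thresholds «M sufficiently large» / (2.59) for ALL Hölder exponents `0 ≤ α < 1`, an `α`-dependent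
constant — p21's files 12–13 of the multi-level parametrix (`B6DualHolderTermMultiLevelBox.aXt_dd_le / bXt_dd_le →
B6Prop22DualHolderMultiLevelBox.dualZero_rowBound / dualPsi_rowBound → hasMajorant_dualHolder_multiLevelBox →
prop22_fifth_multiLevelBox`) RE-THREADED on top of r03's
`B6Prop22DualHolderTwoLevelBoxRateUnif.ineq243_twoLevel_holderDual_wsum2_unif` (`_unif` twins; proofs = the originals
with the `∃`-witnesses reordered; no existing module is touched; no fact is minted)

FRAMING (verbatim cell line):
statement-level skeleton of published theorems with citation tags; proofs where landed; nothing here is a claim about the Yang–Mills mass gap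

Source under audit (cell pub-balaban / lit-balaban): T. Bałaban, *Propagators and renormalization transformations for
lattice gauge theories. II*, Commun. Math. Phys. **96** (1984) 223–250 [`Balaban1984PropagatorsII`, "B6"], p. 234
[PDF 12] (2.64)–(2.67), Proposition 2.2; p. 230 [PDF 8] (2.43)–(2.44); p. 232 [PDF 10] (2.49)/(2.51) (renders
`run/shared/lean/pub/pub-balaban/b2b-balaban-ref1/pages/1984-cmp96-propagators-rt-II/…-p008/p010/p012-x2.png`); [3] =
T. Bałaban, *Regularity and decay of lattice Green's functions*, Commun. Math. Phys. **89** (1983) 571–597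
[`Balaban1983RegularityDecay`, "B4"], Theorem (1.9) p. 573: «δ₀, c₀, R₀ … depending on d, M only, c₀ on α also».
PDF held: `paper:balaban1984-cmp96-propagators-rt-ii` (journal page = PDF page + 222).  Unit `lit-balaban-p21`
(Phase-2 proof seat p21 gen 12), HOME `run/shared/lean/pub/lit-balaban/`, B6 fold owner r03 (row **B6.Prop2.2**),
referee ref-4.

## WHAT IS PRINTED (p. 234, verbatim up to notation)

«**Proposition 2.2.** If we have (2.1), (2.2) and M is sufficiently large, then the operator G′ = Δ′_a^{−1} (a = 1)
satisfies the inequalities |(G′λ)(x)|, |(∇^η_xG′λ)(x)|, |(G′∇^{η*}λ)(x)|, ‖ζ∇^η_xG′λ‖_α, ‖ζG′∇^{η*}λ‖_α, |(Δ^ηG′λ)(x)|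
≤ O(1)[(L^jη)², L^jη, L^jη, (L^jη)^{1−α}(‖ζ‖_α + |ζ|), (L^jη)^{1−α}(‖ζ‖_α + |ζ|), 1]·e^{−½δ₀d(y,y′)}|λ|, x ∈ B^j(y) or
supp ζ ⊂ B^j(y), y ∈ Λ_j, supp λ ⊂ B^{j′}(y′), y′ ∈ Λ_{j′}. (2.67)» — with ONE «δ₀» and ONE «M sufficiently large» for
all the entries, the `α`-dependence being in «O(1)» only (the census typing `B6.Prop22Printed`:
`∃ M₁ δ₀ C, ∃ Cα : ℝ → ℝ, … ∀ α`).

## WHY / WHAT THIS FILE CERTIFIES (kernel-checked)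

p21's k-level entry-5 theorems (gen 11) are stated `∀ α ∃ (δ₀, C, M₀, N₀)` because their column Hölder cube input
`B6Ineq243HolderDualTwoLevelBox.ineq243_twoLevel_holderDual_wsum2` is `∀ α ∃ (δ, c)`.  In the proofs the RATE enters
only through that input (the other cube inputs `ineq243_twoLevel_roww/_dstar_roww/_deriv_wsum`, the single-row and
single-column bounds `aXt_row_le`/`bXt_col_le`, the third entry `prop22_third_multiLevelBox` are `α`-free), «M
sufficiently large» is the third entry's threshold and `N₀` comes from the rate alone; so with r03's
`ineq243_twoLevel_holderDual_wsum2_unif` (`∃ δ ∀ α ∃ c(α)`) the SAME proofs give print's order: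
* §1 `aXt_dd_le_unif` — one term of `G′₀ᵀ∂ᵀ` over a pair of rows of one block: `∃ δ₅ ∀ α ∈ [0,1) ∃ Q(α)`;
* §2 `bXt_dd_le_unif` — one term of `Rᵀ` on the level-weighted input over a pair of columns: `∃ δ₆ ∀ α ∃ Q(α)`
  (the `O(M_h^{−1})` is kept);
* §3 `dualZero_rowBound_unif`, `dualPsi_rowBound_unif` — the pair rows of `T₀ = D_α∘(G′₀ᵀ∂ᵀ)` and of
  `Ψ = D_α∘(RᵀΛ)` summed over the cover: `∃ δ ∀ α ∃ A(α)`;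
* §4 `hasMajorant_dualHolder_multiLevelBox_unif` — the lifted fifth entry: `∃ δ₀ M₀ N₀ ∀ α ∃ C(α)`, and
  **`prop22_fifth_multiLevelBox_unif`** — (2.67)₅ for the genuine `k`-level `G′ = Δ′_a^{−1}` read back on the pairs:
  `∃ δ₀ M₀ N₀ ∀ α ∈ [0,1) ∃ C(α) ∀ k, M_h ≥ 3, L·M_h ≥ M₀, R ≥ 2L, RM ≥ N₀ + 1, P, D, weights, μ, λ, pairs`.

## HONEST SCOPE

Exactly that of the originals (files 12–13): levels `1 … k` on a Neumann box, `m² = 0`, the asymmetric partition,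
`M_h ≥ 3`, `R ≥ 2L`, lattice units (`(L^{j})^{1−α}` for «(L^jη)^{1−α}»; `∂ᵀ` the transposed unit difference,
`η∇^{η*}` of print up to sign), the Hölder pairs = the pairs of ONE block `B^j(y)`, `ζ` dispensed with as in [3] (1.9),
`L`-dependent (2.61)-constant, «M sufficiently large» = the third entry's threshold, constants existential (`δ₀`, `M₀`,
`N₀` functions of `d`, `ℓ`, the windows; `C` of these and `α`).  No new estimate — a change of quantifier order
justified by the existing proofs (ten private plumbing lemmas of files 12–13 are not importable and are COPIED verbatim
as private lemmas).  NOT summit progress.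
-/

namespace Literature.MathematicalPhysics.QuantumFieldTheory.Balaban1983to89.B6Prop22DualHolderMultiLevelBoxRateUnif

open Finset Matrix
open Literature.MathematicalPhysics.QuantumFieldTheory.Balaban1983to89.B4ContourShift (supNorm supNorm_nonneg
  abs_le_supNorm exists_supNorm_eq)
open Literature.MathematicalPhysics.QuantumFieldTheory.Balaban1983to89.B4Reflection242 (boxDom mem_boxDom blk nbrs
  mem_nbrs)
open Literature.MathematicalPhysics.QuantumFieldTheory.Balaban1983to89.B4Lemma22ReduceZero (Box)
open Literature.MathematicalPhysics.QuantumFieldTheory.Balaban1983to89.B4Lemma22ZeroBoxDerivDual (fwd fwd_eq_of_nbr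
  fwd_val_of_mem fwd_of_not_mem)
open Literature.MathematicalPhysics.QuantumFieldTheory.Balaban1983to89.B4PartitionUnity22 (hprof D1 D2 D1_nonneg D2_nonneg
  contDiff_hprof hasCompactSupport_hprof)
open Literature.MathematicalPhysics.QuantumFieldTheory.Balaban1983to89.B4Thm110ZeroBox (boxCast boxCast_apply_val
  boxCast_symm_apply_val mem_boxDom_of_eq roww mulVec_le_of_roww supNorm_sub_le_sub_add_sub)
open Literature.MathematicalPhysics.QuantumFieldTheory.Balaban1983to89.B4Thm110ZeroBoxDeriv (wsum wsum_mul_left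
  supNorm_single_le supNorm_sub_le_nbr)
open Literature.MathematicalPhysics.QuantumFieldTheory.Balaban1983to89.B4Thm19ZeroBoxHolder (wsum2 wsum2_nonneg
  wsum2_le_wsum_left wsum2_mono_rate)
open Literature.MathematicalPhysics.QuantumFieldTheory.Balaban1983to89.B6Ineq243TwoLevelBox
open Literature.MathematicalPhysics.QuantumFieldTheory.Balaban1983to89.B6Ineq243AdjTwoLevelBox (dstar dstar_apply roww_dstar
  ineq243_twoLevel_dstar_roww)
open Literature.MathematicalPhysics.QuantumFieldTheory.Balaban1983to89.B6Partition236TwoLevelBox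
open Literature.MathematicalPhysics.QuantumFieldTheory.Balaban1983to89.B6Eq238TwoLevelBox
open Literature.MathematicalPhysics.QuantumFieldTheory.Balaban1983to89.B6Ineq249TwoLevelBox (near card_near_le
  mem_near_of_abs_lt emb_sub_emb)
open Literature.MathematicalPhysics.QuantumFieldTheory.Balaban1983to89.B6Prop22AdjTwoLevelBox (wsum_kComm_le
  kComm_transpose mul_kComm_apply hLoc_lipschitz hLoc_laplacian_le)
open Literature.MathematicalPhysics.QuantumFieldTheory.Balaban1983to89.B6Prop22DualHolderTwoLevelBox (wsum2_kComm_le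
  cube_pair_wsum2_le cube_pair_diff_wsum2_le)
open Literature.MathematicalPhysics.QuantumFieldTheory.Balaban1983to89.B4Green242Bridge (boxNbrs)
open Literature.MathematicalPhysics.QuantumFieldTheory.Balaban1983to89.B6MultiLevelBoxOperator
open Literature.MathematicalPhysics.QuantumFieldTheory.Balaban1983to89.B6Eq238MultiLevelBox
open Literature.MathematicalPhysics.QuantumFieldTheory.Balaban1983to89.B6Ineq249MultiLevelBox
open Literature.MathematicalPhysics.QuantumFieldTheory.Balaban1983to89.B6Geom246MultiLevelBox
open Literature.MathematicalPhysics.QuantumFieldTheory.Balaban1983to89.B6Prop22MultiLevelBox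
open Literature.MathematicalPhysics.QuantumFieldTheory.Balaban1983to89.B6Prop22DerivMultiLevelBox (dMat
  dMat_mulVec_of_mem dMat_mulVec_of_not_mem img_of_uX_ne_zero mem_keySet_of_uX_ne_zero)
open Literature.MathematicalPhysics.QuantumFieldTheory.Balaban1983to89.B6Prop22AdjMultiLevelBox (levW
  bX_transpose_mulVec_img bX_transpose_mulVec_off gX_apply_img gX_apply_off gX_symm aXt_dMatt_apply aXt_dMatt_apply_off)
open Literature.MathematicalPhysics.QuantumFieldTheory.Balaban1983to89.B6HolderTermMultiLevelBox (img_of_near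
  supNorm_le_of_blkOf_eq)
open Literature.MathematicalPhysics.QuantumFieldTheory.Balaban1983to89.B6Prop22HolderTwoLevelBox (exists_emb_eq_of_near
  wsum_longDiff_le)
open Literature.MathematicalPhysics.QuantumFieldTheory.Balaban1983to89.B6RandomWalk (HasMajorant BlockSupp
  hasMajorant_mono hasMajorant_add hasMajorant_mul Triangle254)
open Literature.MathematicalPhysics.QuantumFieldTheory.Balaban1983to89.B6Prop22AdjMultiLevelBox (fixedPoint_transpose
  conv_left_le hasMajorant_diagonal_mul prop22_third_multiLevelBox)
open Literature.MathematicalPhysics.QuantumFieldTheory.Balaban1983to89.B6Prop22HolderMultiLevelBox (liftL liftR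
  liftL_apply_inl liftL_add liftL_mul_liftR hasMajorant_liftR hasMajorant_liftL rowBound_of_hasMajorant_liftL)
open Literature.MathematicalPhysics.QuantumFieldTheory.Balaban1983to89.B6DualHolderTermMultiLevelBox (colKer
  aXt_dMatt_eq_vX_mul aXt_dMatt_mulVec abs_vX_sub_le abs_vX_le_one vX_eq_zero_of_uX colKer_off abs_colKer_img_le core_le
  aXt_row_le core_pair_le bXt_pair_near_le bXt_col_le bXt_col_eq_zero_of_uX)
open Literature.MathematicalPhysics.QuantumFieldTheory.Balaban1983to89.B6Prop22DualHolderMultiLevelBox (BPair blkB Dh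
  dualOp dualOp_apply dual_identity levW_neg_one_eq)
open Literature.MathematicalPhysics.QuantumFieldTheory.Balaban1983to89.B6Lemma21Repaired (Ineq261With)
open Literature.MathematicalPhysics.QuantumFieldTheory.Balaban1983to89.B6Ineq261LevelGap (K261 K261_nonneg
  theta_lt_one_of_log)
open Literature.MathematicalPhysics.QuantumFieldTheory.Balaban1983to89.B6Prop22DualHolderTwoLevelBoxRateUnif
  (ineq243_twoLevel_holderDual_wsum2_unif)

noncomputable section

variable {d : ℕ}

/-! ## §0 Tools (private copies of the non-importable plumbing of files 12–13) -/

section Tools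

/-- a sum over a finite type whose non-zero terms are indexed injectively into a finset `T` and are bounded by
`B ≥ 0` is at most `|T|·B`. [folklore] -/
private theorem sum_le_card_mul {ι σ : Type*} [Fintype ι] [DecidableEq σ] (f : ι → ℝ) (key : ι → σ)
    (hkey : Function.Injective key) (T : Finset σ) (hT : ∀ i, f i ≠ 0 → key i ∈ T) {B : ℝ} (hB : 0 ≤ B)
    (hf : ∀ i, f i ≤ B) : ∑ i, f i ≤ T.card * B := by
  classical
  rw [← Finset.sum_filter_ne_zero]
  have hcard : (Finset.univ.filter fun i => f i ≠ 0).card ≤ T.card :=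
    Finset.card_le_card_of_injOn key (fun i hi => by
      rw [Finset.coe_filter] at hi; exact hT i hi.2) (fun i _ j _ h => hkey h)
  calc ∑ i ∈ Finset.univ.filter (fun i => f i ≠ 0), f i
      ≤ (Finset.univ.filter fun i => f i ≠ 0).card • B := Finset.sum_le_card_nsmul _ _ _ fun i _ => hf i
    _ = ((Finset.univ.filter fun i => f i ≠ 0).card : ℝ) * B := by rw [nsmul_eq_mul]
    _ ≤ T.card * B := mul_le_mul_of_nonneg_right (by exact_mod_cast hcard) hB

/-- the exponent bookkeeping: `e^{−δD/L^i} = e^{δ}·e^{−(δ/(d+1))·dist}` for `D = L^i(dist/(d+1) − 1)`. [folklore] -/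
private theorem exp_Dd_eq {δ n dist : ℝ} (hn : 0 < n) (d : ℕ) :
    Real.exp (-(δ * (n * (dist / (d + 1) - 1)) / n)) = Real.exp δ * Real.exp (-(δ / (d + 1) * dist)) := by
  rw [← Real.exp_add]
  congr 1
  field_simp
  ring

/-- the weakening of a rate against a non-negative distance. [folklore] -/
private theorem exp_rate_mono {δ δ' dist : ℝ} (hδ : δ' ≤ δ) (hdist : 0 ≤ dist) (d : ℕ) :
    Real.exp (-(δ / (d + 1) * dist)) ≤ Real.exp (-(δ' / (d + 1) * dist)) := by
  rw [Real.exp_le_exp, neg_le_neg_iff]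
  exact mul_le_mul_of_nonneg_right (div_le_div_of_nonneg_right hδ (by positivity)) hdist

/-- the two exponent steps: `e^{−δD/n} ≤ e^{2δ}·e^{−(δ′/(d+1))dist}`. [folklore] -/
private theorem exp_Dd_le {δ δ' n dist : ℝ} (hδ : 0 ≤ δ) (hδ' : δ' ≤ δ) (hn : 1 ≤ n) (hdist : 0 ≤ dist) (d : ℕ) :
    Real.exp (-(δ * (n * (dist / (d + 1) - 1)) / n))
      ≤ Real.exp δ * Real.exp δ * Real.exp (-(δ' / (d + 1) * dist)) := by
  have hn0 : 0 < n := by linarith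
  rw [exp_Dd_eq hn0 d, mul_assoc]
  have h1 : (1 : ℝ) ≤ Real.exp δ := Real.one_le_exp hδ
  calc Real.exp δ * Real.exp (-(δ / (d + 1) * dist))
      ≤ Real.exp δ * Real.exp (-(δ' / (d + 1) * dist)) :=
        mul_le_mul_of_nonneg_left (exp_rate_mono hδ' hdist d) (Real.exp_pos _).le
    _ = 1 * (Real.exp δ * Real.exp (-(δ' / (d + 1) * dist))) := (one_mul _).symm
    _ ≤ Real.exp δ * (Real.exp δ * Real.exp (-(δ' / (d + 1) * dist))) :=
        mul_le_mul_of_nonneg_right h1 (by positivity)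

/-- the weighted functional is monotone in the rate. [folklore] -/
private theorem wsum_mono_rate {N : Fin (d + 1) → ℕ} {δ δ' : ℝ} (h : δ ≤ δ') (n : ℕ) (x : ↥(boxDom N))
    (g : ↥(boxDom N) → ℝ) : wsum δ n x g ≤ wsum δ' n x g := by
  unfold wsum
  refine Finset.sum_le_sum fun z _ => mul_le_mul_of_nonneg_left ?_ (abs_nonneg _)
  rw [Real.exp_le_exp]
  exact div_le_div_of_nonneg_right (mul_le_mul_of_nonneg_right h (supNorm_nonneg _)) (Nat.cast_nonneg _)

/-- Hölder weights: `s^{−α}·s = s^{1−α} ≤ T^{1−α}` for `0 < s ≤ T`, `α ≤ 1`. [folklore] -/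
private theorem rpow_neg_mul_self_le {s T α : ℝ} (hs : 0 < s) (hsT : s ≤ T) (hα : α ≤ 1) :
    s ^ (-α) * s ≤ T ^ (1 - α) := by
  have e : s ^ (-α) * s = s ^ (1 - α) := by
    rw [show (1 : ℝ) - α = -α + 1 by ring, Real.rpow_add hs, Real.rpow_one]
  rw [e]
  exact Real.rpow_le_rpow hs.le hsT (by linarith)

/-- Hölder weights: `n^{1−α} ≤ T^{1−α}` for `0 ≤ n ≤ T`, `α ≤ 1`. [folklore] -/
private theorem rpow_one_sub_le {n T α : ℝ} (hn : 0 ≤ n) (hnT : n ≤ T) (hα : α ≤ 1) :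
    n ^ (1 - α) ≤ T ^ (1 - α) :=
  Real.rpow_le_rpow hn hnT (by linarith)

/-- Hölder weights: `s^{−α} = n^{−α}·(n/s)^α` (`n, s > 0`). [folklore] -/
private theorem rpow_neg_eq {n s α : ℝ} (hn : 0 < n) (hs : 0 < s) :
    s ^ (-α) = n ^ (-α) * (n / s) ^ α := by
  rw [Real.div_rpow hn.le hs.le, Real.rpow_neg hs.le, Real.rpow_neg hn.le]
  have hnα : n ^ α ≠ 0 := (Real.rpow_pos_of_pos hn α).ne'
  field_simp

/-- Hölder weights, far pairs: `s^{−α}·T ≤ L·T^{1−α}` when `T ≤ L·n`, `n ≤ s`, `0 ≤ α ≤ 1`, `L ≥ 1`, `n, T > 0`.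
[folklore] -/
private theorem rpow_far_le {n s T L α : ℝ} (hn : 0 < n) (hns : n ≤ s) (hT : 0 < T) (hTL : T ≤ L * n)
    (hL : 1 ≤ L) (hα0 : 0 ≤ α) (hα1 : α ≤ 1) : s ^ (-α) * T ≤ L * T ^ (1 - α) := by
  have hL0 : 0 < L := by linarith
  have h1 : s ^ (-α) ≤ n ^ (-α) := Real.rpow_le_rpow_of_nonpos hn hns (by linarith)
  have hTLn : T / L ≤ n := by rw [div_le_iff₀ hL0]; linarith
  have h2 : n ^ (-α) ≤ (T / L) ^ (-α) := Real.rpow_le_rpow_of_nonpos (div_pos hT hL0) hTLn (by linarith)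
  have h3 : (T / L) ^ (-α) = L ^ α * T ^ (-α) := by
    rw [Real.div_rpow hT.le hL0.le, Real.rpow_neg hT.le, Real.rpow_neg hL0.le]
    field_simp
  have h4 : L ^ α ≤ L := B4Thm19ZeroBoxHolder.rpow_le_self_of_one_le hL hα1
  have h5 : T ^ (-α) * T = T ^ (1 - α) := by
    rw [show (1 : ℝ) - α = -α + 1 by ring, Real.rpow_add hT, Real.rpow_one]
  have hTα : 0 ≤ T ^ (-α) := Real.rpow_nonneg hT.le _
  calc s ^ (-α) * T ≤ L ^ α * T ^ (-α) * T := by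
        refine mul_le_mul_of_nonneg_right (h1.trans (h2.trans h3.le)) hT.le
    _ ≤ L * T ^ (-α) * T := by gcongr
    _ = L * T ^ (1 - α) := by rw [mul_assoc, h5]


end Tools

/-- `|−x|_∞ = |x|_∞`. [folklore] -/
private theorem supNorm_neg' (x : Fin (d + 1) → ℤ) : supNorm (-x) = supNorm x := by
  unfold B4ContourShift.supNorm
  congr 1
  funext i
  simp

/-- the sup distance is symmetric. [folklore] -/
private theorem supNorm_sub_comm (x y : Fin (d + 1) → ℤ) : supNorm (x - y) = supNorm (y - x) := by
  rw [← supNorm_neg', neg_sub]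

/-! ## §1 One term of `G′₀ᵀ∂ᵀ` over a pair of rows of one block, rate uniform in `α` -/

section RowPair

variable {ℓ Mh k R : ℕ} {P : Fin (d + 1) → ℕ} {D : Domains d ℓ Mh k P R} {a c : ℕ → ℝ}

set_option maxHeartbeats 1600000 in
/-- **ONE TERM OF `G′₀ᵀ∂ᵀ` OVER A PAIR OF ROWS IN ONE BLOCK, RATE UNIFORM IN `α`** — p21's
`B6DualHolderTermMultiLevelBox.aXt_dd_le` in print's quantifier order `∃ δ₅ ∀ α ∈ [0,1) ∃ Q(α)`:
`|x̂−x|_∞^{−α}·|((v_□G′(□)h_□∂ᵀ)λ)(x̂) − ((v_□G′(□)h_□∂ᵀ)λ)(x)| ≤ (L^{j})^{1−α}·Q·e^{−δ₅d(y,y′)/(d+1)}·sup|λ|` for `x ≠ x̂` in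
one `j`-block `y` and `λ` supported in the block `y′`; the rate `δ₅ = min(δ(2.43)₁, δ(2.43)∂*, δ(2.43)₂, δ_H)` is `α`-free
because the column Hölder cube input is now `…B6Prop22DualHolderTwoLevelBoxRateUnif.ineq243_twoLevel_holderDual_wsum2_unif`.
Proof = the original (near pairs by `core_le`/`core_pair_le` and the cut-off jump, far pairs by `aXt_row_le` twice) with
the `∃`-witnesses reordered.
[cite: Balaban1984PropagatorsII, Proposition 2.2 (2.67) p.234 (fifth entry), (2.43) p.230; Balaban1983RegularityDecay, Theorem (1.9) p.573] -/
theorem aXt_dd_le_unif (d ℓ : ℕ) (hℓ : 1 ≤ ℓ) (aminus aplus a2minus a2plus : ℝ) (ha : 0 < aminus)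
    (ha2 : 0 < a2minus) :
    ∃ δ₅ : ℝ, 0 < δ₅ ∧ ∀ (α : ℝ), 0 ≤ α → α < 1 → ∃ Q : ℝ, 0 < Q ∧ ∀ (k Mh R : ℕ), 3 ≤ Mh → 2 * (ℓ + 1) ≤ R →
      ∀ (P : Fin (d + 1) → ℕ) (hP : ∀ μ, 1 ≤ P μ) (D : Domains d ℓ Mh k P R) (a c : ℕ → ℝ),
        (∀ i, 1 ≤ i → aminus ≤ a i ∧ a i ≤ aplus) → (∀ i, 1 ≤ i → a2minus ≤ c i ∧ c i ≤ a2plus) →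
        ∀ (μ : Fin (d + 1)) (y' : ↥(bset D)) (lam : ↥(boxDom (N0 ℓ Mh k P)) → ℝ) (B : ℝ),
          BlockSupp (g := geom D) (blkOf D) lam y' B →
          ∀ (x x' : ↥(boxDom (N0 ℓ Mh k P))), x'.1 ≠ x.1 → blkOf D x' = blkOf D x →
          ∀ (cq : ℕ × (Fin (d + 1) → ℤ)) (hc : CubeData D cq),
            (supNorm (x'.1 - x.1)) ^ (-α)
                * |((((aX D a c hP cq hc)ᵀ * (dMat (N0 ℓ Mh k P) μ)ᵀ) *ᵥ lam) x'
                    - (((aX D a c hP cq hc)ᵀ * (dMat (N0 ℓ Mh k P) μ)ᵀ) *ᵥ lam) x)|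
              ≤ (((ℓ : ℝ) + 1) ^ D.lev x.1) ^ (1 - α)
                * (Q * Real.exp (-(δ₅ / (d + 1) * (geom D).dist (blkOf D x) y')) * B) := by
  obtain ⟨δ'', c', hδ'', hc', h243⟩ := ineq243_twoLevel_roww d ℓ hℓ aminus aplus 0 a2minus a2plus ha ha2
  obtain ⟨δs, cs, hδs, hcs, h243s⟩ := ineq243_twoLevel_dstar_roww d ℓ hℓ aminus aplus 0 a2minus a2plus ha ha2
  obtain ⟨δd, cd, hδd, hcd, h243d⟩ := ineq243_twoLevel_deriv_wsum d ℓ hℓ aminus aplus 0 a2minus a2plus ha ha2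
  obtain ⟨δH, hδH, hHA⟩ := ineq243_twoLevel_holderDual_wsum2_unif d ℓ hℓ aminus aplus 0 a2minus a2plus ha ha2
  have hD1 := D1_nonneg contDiff_hprof hasCompactSupport_hprof
  obtain ⟨δ₅, hδ₅⟩ : ∃ t : ℝ, t = min (min δ'' δs) (min δd δH) := ⟨_, rfl⟩
  have hδ₅pos : 0 < δ₅ := by rw [hδ₅]; exact lt_min (lt_min hδ'' hδs) (lt_min hδd hδH)
  have h51 : δ₅ ≤ δ'' := by rw [hδ₅]; exact (min_le_left _ _).trans (min_le_left _ _)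
  have h52 : δ₅ ≤ δs := by rw [hδ₅]; exact (min_le_left _ _).trans (min_le_right _ _)
  have h53 : δ₅ ≤ δd := by rw [hδ₅]; exact (min_le_right _ _).trans (min_le_left _ _)
  have h54 : δ₅ ≤ δH := by rw [hδ₅]; exact (min_le_right _ _).trans (min_le_right _ _)
  obtain ⟨Q'', hQ''⟩ : ∃ t : ℝ, t = (d + 1) * D1 hprof * c' + cs := ⟨_, rfl⟩
  have hQ''0 : 0 ≤ Q'' := by rw [hQ'']; have := hc'.le; have := hcs.le; positivity
  obtain ⟨EE, hEE⟩ : ∃ t : ℝ, t = Real.exp δ₅ * Real.exp δ₅ := ⟨_, rfl⟩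
  have hEE1 : 1 ≤ EE := by
    rw [hEE]; have h1 : (1 : ℝ) ≤ Real.exp δ₅ := Real.one_le_exp hδ₅pos.le; nlinarith
  have hEE0 : 0 ≤ EE := zero_le_one.trans hEE1
  refine ⟨δ₅, hδ₅pos, fun α hα0 hα1 => ?_⟩
  obtain ⟨cH, hcH, hH⟩ := hHA α hα0 hα1
  obtain ⟨Qp, hQp⟩ : ∃ t : ℝ, t = ((d + 1) * ((d + 1) * D1 hprof) * EE * cd + cH) * EE := ⟨_, rfl⟩
  have hQp0 : 0 ≤ Qp := by rw [hQp]; have := hcd.le; have := hcH.le; positivity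
  refine ⟨(d + 1) * D1 hprof * (Q'' * EE) + Qp + 2 * ((ℓ : ℝ) + 1) * (Q'' * EE) + 1, by positivity, ?_⟩
  intro k Mh R hMh hR P hP D a c haw hcw μ y' lam B hlam x x' hne hblk cq hc
  obtain ⟨hi1, hij, hji, -, -⟩ := fin_data hc
  have hjk := hc.hj.2
  have hMh1 : 1 ≤ Mh := le_trans (by norm_num) hMh
  have hL1 : (1 : ℝ) ≤ (ℓ : ℝ) + 1 := by linarith [(Nat.cast_nonneg ℓ : (0 : ℝ) ≤ ℓ)]
  have hB0 : 0 ≤ B := hlam.nonneg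
  have hlamB : ∀ w, |lam w| ≤ B := fun w => BlockSupp.abs_le hlam w
  obtain ⟨dist0, hdist0⟩ : ∃ t : ℝ, t = (((bond D).dist (blkOf D x) y' : ℕ) : ℝ) := ⟨_, rfl⟩
  have hgeom : (geom D).dist (blkOf D x) y' = dist0 := by rw [hdist0]; rfl
  have hgeom' : (geom D).dist (blkOf D x') y' = dist0 := by rw [hblk, hgeom]
  have hdist0nn : 0 ≤ dist0 := by rw [hdist0]; positivity
  rw [hgeom]
  obtain ⟨E5, hE5⟩ : ∃ t : ℝ, t = Real.exp (-(δ₅ / (d + 1) * dist0)) := ⟨_, rfl⟩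
  rw [← hE5]
  have hE50 : 0 ≤ E5 := by rw [hE5]; exact (Real.exp_pos _).le
  obtain ⟨LJ, hLJ⟩ : ∃ t : ℝ, t = ((ℓ : ℝ) + 1) ^ D.lev x.1 := ⟨_, rfl⟩
  rw [← hLJ]
  have hLJ0 : 0 < LJ := by rw [hLJ]; positivity
  have hLJα0 : 0 ≤ LJ ^ (1 - α) := Real.rpow_nonneg hLJ0.le _
  have hRHS0 : 0 ≤ LJ ^ (1 - α)
      * (((d + 1) * D1 hprof * (Q'' * EE) + Qp + 2 * ((ℓ : ℝ) + 1) * (Q'' * EE) + 1) * E5 * B) := by positivity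
  obtain ⟨s, hs⟩ : ∃ t : ℝ, t = supNorm (x'.1 - x.1) := ⟨_, rfl⟩
  have hs1 : 1 ≤ s := by rw [hs]; exact B4StripSumsHolder.one_le_supNorm (sub_ne_zero.2 hne)
  have hs0 : 0 < s := lt_of_lt_of_le one_pos hs1
  rw [← hs]
  have hW0 : 0 ≤ s ^ (-α) := Real.rpow_nonneg hs0.le _
  -- the trivial case: `h_□` vanishes at both points
  by_cases h0 : uX (ℓ := ℓ) (Mh := Mh) (k := k) (P := P) cq x = 0 ∧ uX (ℓ := ℓ) (Mh := Mh) (k := k) (P := P) cq x' = 0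
  · rw [aXt_dMatt_mulVec hP cq hc μ lam x, aXt_dMatt_mulVec hP cq hc μ lam x', vX_eq_zero_of_uX cq h0.1,
      vX_eq_zero_of_uX cq h0.2]
    simp only [zero_mul, sub_self, abs_zero, mul_zero]
    exact hRHS0
  have hu : uX (ℓ := ℓ) (Mh := Mh) (k := k) (P := P) cq x ≠ 0 ∨ uX (ℓ := ℓ) (Mh := Mh) (k := k) (P := P) cq x' ≠ 0 := by
    by_contra h'; push Not at h'; exact h0 ⟨h'.1, h'.2⟩
  -- the level window at `x`
  have hlevx' : D.lev x'.1 = D.lev x.1 := congrArg (fun s : ↥(bset D) => s.1.1) hblk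
  have hzval : ∀ w : ↥(boxDom (N0 ℓ Mh k P)), ((castP (ℓ := ℓ) (Mh := Mh) (P := P) hij hjk).symm w).1 = w.1 :=
    fun w => by unfold castP; exact boxCast_symm_apply_val _ _
  have hinc : ∀ (w : ↥(boxDom (N0 ℓ Mh k P))) (bw : ↥(Box d ℓ (fin D cq.1 cq.2)
      (fun ν => (ℓ + 1) * cubeM' (MhP ℓ Mh cq.1 (fin D cq.1 cq.2)) (Pj ℓ k P cq.1) cq.2 ν))),
      embC D hP cq hc bw = (castP (ℓ := ℓ) (Mh := Mh) (P := P) hij hjk).symm w → InCube ℓ Mh k P cq.1 cq.2 w.1 :=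
    fun w bw hbw => by rw [← hzval w]; exact (inCube_iff_exists_emb (Mh := Mh) hP hij hc.hq _).2 ⟨bw, hbw⟩
  have hwin : fin D cq.1 cq.2 ≤ D.lev x.1 ∧ D.lev x.1 ≤ fin D cq.1 cq.2 + 1 := by
    rcases hu with h | h
    · obtain ⟨bw, hbw⟩ := img_of_uX_ne_zero hℓ hP hMh1 cq hc h (Or.inr rfl)
      exact lev_window_of_inCube hℓ hR hP hMh1 hc x.2 (hinc x bw hbw)
    · obtain ⟨bw, hbw⟩ := img_of_uX_ne_zero hℓ hP hMh1 cq hc h (Or.inr rfl)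
      rw [← hlevx']; exact lev_window_of_inCube hℓ hR hP hMh1 hc x'.2 (hinc x' bw hbw)
  obtain ⟨nn, hnn⟩ : ∃ t : ℝ, t = (((ℓ + 1) ^ fin D cq.1 cq.2 : ℕ) : ℝ) := ⟨_, rfl⟩
  have hncast : nn = ((ℓ : ℝ) + 1) ^ fin D cq.1 cq.2 := by rw [hnn]; push_cast; ring
  have hn1' : 1 ≤ (ℓ + 1) ^ fin D cq.1 cq.2 := Nat.one_le_pow _ _ (by omega)
  have hn1 : (1 : ℝ) ≤ nn := by rw [hnn]; exact_mod_cast hn1'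
  have hn0 : (0 : ℝ) < nn := lt_of_lt_of_le one_pos hn1
  have hnLJ : nn ≤ LJ := by rw [hncast, hLJ]; exact pow_le_pow_right₀ hL1 hwin.1
  have hT : LJ ≤ ((ℓ : ℝ) + 1) * nn := by
    rw [hLJ, hncast, ← pow_succ']; exact pow_le_pow_right₀ hL1 hwin.2
  obtain ⟨Nj, hNj⟩ : ∃ t : ℝ, t = (((ℓ + 1) ^ cq.1 : ℕ) : ℝ) := ⟨_, rfl⟩
  have hNj1' : 1 ≤ (ℓ + 1) ^ cq.1 := Nat.one_le_pow _ _ (by omega)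
  have hNj0 : 0 < Nj := by rw [hNj]; exact_mod_cast hNj1'
  have hnNj : nn ≤ Nj := by
    rw [hnn, hNj]; exact_mod_cast Nat.pow_le_pow_right (by omega) hij
  have hM1 : 1 ≤ (ℓ + 1) * Mh := Nat.one_le_iff_ne_zero.2 (Nat.mul_ne_zero_iff.2 ⟨by omega, by omega⟩)
  -- the per-cube inputs
  have hcM' : ∀ ν, 1 ≤ cubeM' (MhP ℓ Mh cq.1 (fin D cq.1 cq.2)) (Pj ℓ k P cq.1) cq.2 ν := fun ν =>
    Nat.one_le_iff_ne_zero.2 (Nat.mul_ne_zero_iff.2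
      ⟨by have := one_le_MhP (ℓ := ℓ) hMh1 cq.1 (fin D cq.1 cq.2); omega,
        by have := (one_le_cubeW (one_le_Pj hP cq.1) hc.hq ν).1; omega⟩)
  have h243c : ∀ b, roww δ'' ((ℓ + 1) ^ fin D cq.1 cq.2) (cG D a c cq.1 (fin D cq.1 cq.2) cq.2 hP hc.hq) b ≤ c' :=
    fun b => h243 (fin D cq.1 cq.2) hi1 (a (fin D cq.1 cq.2)) 0 (c (fin D cq.1 cq.2)) (haw _ hi1).1 (haw _ hi1).2
      le_rfl le_rfl (hcw _ hi1).1 (hcw _ hi1).2 _ hcM' _ b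
  have h243sc : ∀ b, roww δs ((ℓ + 1) ^ fin D cq.1 cq.2)
      (dstar ((ℓ + 1) ^ fin D cq.1 cq.2) μ (cG D a c cq.1 (fin D cq.1 cq.2) cq.2 hP hc.hq)) b ≤ cs :=
    fun b => h243s (fin D cq.1 cq.2) hi1 (a (fin D cq.1 cq.2)) 0 (c (fin D cq.1 cq.2)) (haw _ hi1).1 (haw _ hi1).2
      le_rfl le_rfl (hcw _ hi1).1 (hcw _ hi1).2 _ hcM'
      (lamLoc ℓ (MhP ℓ Mh cq.1 (fin D cq.1 cq.2)) (Pj ℓ k P cq.1) cq.2 (one_le_Pj hP cq.1) hc.hq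
        (LamG D cq.1 (fin D cq.1 cq.2))) μ b
  have hrow := aXt_row_le (a := a) (c := c) hℓ hR hP hMh1 cq hc μ hδ₅pos.le h51 h52 hc'.le hcs.le h243c h243sc
    y' lam B hlam
  have hrowx := hrow x
  have hrowx' := hrow x'
  rw [hgeom, ← hE5, ← hnn, ← hQ'', ← hEE] at hrowx
  rw [hgeom', ← hE5, ← hnn, ← hQ'', ← hEE] at hrowx'
  by_cases hnear : s + 1 ≤ 2 * nn
  · -- NEAR PAIRS: both points lie in the cube image
    obtain ⟨b, b', hb, hb'⟩ : ∃ b b', embC D hP cq hc b = (castP (ℓ := ℓ) (Mh := Mh) (P := P) hij hjk).symm x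
        ∧ embC D hP cq hc b' = (castP (ℓ := ℓ) (Mh := Mh) (P := P) hij hjk).symm x' := by
      have hd1 : supNorm (x'.1 - x.1) ≤ 2 * (((ℓ + 1) ^ fin D cq.1 cq.2 : ℕ) : ℝ) := by
        rw [← hs, ← hnn]; linarith only [hnear]
      have hd2 : supNorm (x.1 - x'.1) ≤ 2 * (((ℓ + 1) ^ fin D cq.1 cq.2 : ℕ) : ℝ) := by
        rw [supNorm_sub_comm]; exact hd1
      have hd0 : ∀ w : ↥(boxDom (N0 ℓ Mh k P)), supNorm (w.1 - w.1) ≤ 2 * (((ℓ + 1) ^ fin D cq.1 cq.2 : ℕ) : ℝ) := by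
        intro w
        have h0 : supNorm (w.1 - w.1) = 0 := by rw [sub_self]; unfold B4ContourShift.supNorm; simp
        rw [h0]; positivity
      rcases hu with h | h
      · obtain ⟨b, hb⟩ := img_of_near hℓ hP hMh cq hc h (hd0 x)
        obtain ⟨b', hb'⟩ := img_of_near hℓ hP hMh cq hc h hd1
        exact ⟨b, b', hb, hb'⟩
      · obtain ⟨b, hb⟩ := img_of_near hℓ hP hMh cq hc h hd2
        obtain ⟨b', hb'⟩ := img_of_near hℓ hP hMh cq hc h (hd0 x')
        exact ⟨b, b', hb, hb'⟩
    have hbx : (embC D hP cq hc b).1 = x.1 := by rw [hb, hzval]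
    have hb'x : (embC D hP cq hc b').1 = x'.1 := by rw [hb', hzval]
    have hsubE : ∀ u v, (embC D hP cq hc u).1 - (embC D hP cq hc v).1 = u.1 - v.1 := fun u v => by
      unfold embC; exact emb_sub_emb _ hc.hq u v
    have hb'b : b'.1 - b.1 = x'.1 - x.1 := by rw [← hsubE b' b, hb'x, hbx]
    have hsb : supNorm (b'.1 - b.1) = s := by rw [hb'b, hs]
    have hneb : b'.1 ≠ b.1 := fun h => hne (by
      have := hb'b; rw [h, sub_self] at this; exact (sub_eq_zero.1 this.symm))
    have hxin : InCube ℓ Mh k P cq.1 cq.2 x.1 := hinc x b hb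
    have hx'in : InCube ℓ Mh k P cq.1 cq.2 x'.1 := hinc x' b' hb'
    -- support distances of `λ` read on the cube, from `x` and from `x̂`
    obtain ⟨Dd, hDd⟩ : ∃ t : ℝ, t = nn * (dist0 / (d + 1) - 1) := ⟨_, rfl⟩
    have hDgen : ∀ (w : ↥(boxDom (N0 ℓ Mh k P))) (bw : ↥(Box d ℓ (fin D cq.1 cq.2)
        (fun ν => (ℓ + 1) * cubeM' (MhP ℓ Mh cq.1 (fin D cq.1 cq.2)) (Pj ℓ k P cq.1) cq.2 ν))),
        (embC D hP cq hc bw).1 = w.1 → InCube ℓ Mh k P cq.1 cq.2 w.1 → (geom D).dist (blkOf D w) y' = dist0 →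
        ∀ z, lam (castP (fin_data hc).2.1 hc.hj.2 (embC D hP cq hc z)) ≠ 0 → Dd ≤ supNorm (bw.1 - z.1) := by
      intro w bw hbw hwin' hwd z hz
      set x'' : ↥(boxDom (N0 ℓ Mh k P)) := castP (fin_data hc).2.1 hc.hj.2 (embC D hP cq hc z) with hx''
      have hx''val : x''.1 = (embC D hP cq hc z).1 := by
        rw [hx'']; unfold castP; exact boxCast_apply_val _ _
      have hx''in : InCube ℓ Mh k P cq.1 cq.2 x''.1 := by
        rw [hx''val]
        exact (inCube_iff_exists_emb (Mh := Mh) hP hij hc.hq _).2 ⟨z, rfl⟩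
      have hblk'' : blkOf D x'' = y' := by
        by_contra hne'
        exact hz (hlam.off x'' hne')
      have h := Dd_le_supNorm hℓ hR hP hMh1 hc w x'' hwin' hx''in y' hblk''
      have hsub : w.1 - x''.1 = bw.1 - z.1 := by rw [hx''val, ← hbw]; exact hsubE bw z
      rw [hsub] at h
      have hd' : (((bond D).dist (blkOf D w) y' : ℕ) : ℝ) = dist0 := hwd
      rw [hd', ← hnn, ← hDd] at h
      exact h
    have hD_b := hDgen x b hbx hxin hgeom
    have hD_b' := hDgen x' b' hb'x hx'in hgeom'
    have hexp : Real.exp (-(δ₅ * Dd / nn)) ≤ EE * E5 := by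
      rw [hDd, hEE, hE5]; exact exp_Dd_le hδ₅pos.le le_rfl hn1 hdist0nn d
    -- the core at `x̂` and the core pair
    have hcore' := core_le (a := a) (c := c) hℓ hP hMh1 cq hc μ hδ₅pos.le h51 h52 h243c h243sc lam hB0
      (fun z => hlamB _) hb' hD_b'
    rw [← hnn, ← hQ''] at hcore'
    have hpair := core_pair_le (a := a) (c := c) hℓ hP hMh1 cq hc μ (α := α) hδ₅pos.le h53 h54 hcd.le
      (fun i u ue hue => h243d (fin D cq.1 cq.2) hi1 (a (fin D cq.1 cq.2)) 0 (c (fin D cq.1 cq.2)) (haw _ hi1).1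
        (haw _ hi1).2 le_rfl le_rfl (hcw _ hi1).1 (hcw _ hi1).2 _ hcM' _ i u ue hue)
      (fun u u' hne' => hH (fin D cq.1 cq.2) hi1 (a (fin D cq.1 cq.2)) 0 (c (fin D cq.1 cq.2))
        (haw _ hi1).1 (haw _ hi1).2 le_rfl le_rfl (hcw _ hi1).1 (hcw _ hi1).2 _ hcM' _ μ u u' hne')
      lam hB0 (fun z => hlamB _) hb hb' hneb (by rw [hsb, ← hnn]; exact hnear) hD_b hD_b'
    rw [hsb, ← hnn, ← hNj, ← hEE] at hpair
    -- the cut-off difference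
    have hdv : |vX D cq x' - vX D cq x| ≤ (d + 1) * D1 hprof * s / Nj := by
      refine (abs_vX_sub_le (D := D) cq hlevx').trans ?_
      have h := abs_hq_sub_le (d := d) hNj1' hM1 cq.2 x.1 x'.1
      rw [← hNj, ← hs] at h
      refine h.trans (div_le_div_of_nonneg_right ?_ hNj0.le)
      have hMr : (1 : ℝ) ≤ (((ℓ + 1) * Mh : ℕ) : ℝ) := by exact_mod_cast hM1
      exact mul_le_mul_of_nonneg_right (div_le_self (by positivity) hMr) hs0.le
    have hvx : |vX D cq x| ≤ 1 := abs_vX_le_one cq x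
    -- the Hölder weights
    have hWs : s ^ (-α) * s ≤ LJ ^ (1 - α) := by
      refine rpow_neg_mul_self_le hs0 ?_ hα1.le
      have h := supNorm_le_of_blkOf_eq (D := D) hblk
      have e : (((ℓ + 1) ^ D.lev x.1 : ℕ) : ℝ) = LJ := by rw [hLJ]; push_cast; ring
      rw [← hs, e] at h
      exact h.trans (sub_le_self _ zero_le_one)
    have hnα : nn ^ (1 - α) ≤ LJ ^ (1 - α) := rpow_one_sub_le hn0.le hnLJ hα1.le
    have hnNj' : nn / Nj ≤ 1 := by rw [div_le_one hNj0]; exact hnNj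
    -- the product rule
    rw [aXt_dMatt_mulVec hP cq hc μ lam x, aXt_dMatt_mulVec hP cq hc μ lam x']
    obtain ⟨Cx, hCx⟩ : ∃ t : ℝ, t = ∑ z, colKer D a c hP cq hc μ x z * lam z := ⟨_, rfl⟩
    obtain ⟨Cx', hCx'⟩ : ∃ t : ℝ, t = ∑ z, colKer D a c hP cq hc μ x' z * lam z := ⟨_, rfl⟩
    have hdiffC : ∑ z, (colKer D a c hP cq hc μ x' z - colKer D a c hP cq hc μ x z) * lam z = Cx' - Cx := by
      rw [hCx, hCx', ← Finset.sum_sub_distrib]; exact Finset.sum_congr rfl fun z _ => by ring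
    rw [hdiffC] at hpair
    rw [← hCx'] at hcore'
    rw [← hCx, ← hCx']
    have e1 : s ^ (-α) * |vX D cq x' * Cx' - vX D cq x * Cx|
        = |s ^ (-α) * (vX D cq x' - vX D cq x) * Cx' + vX D cq x * (s ^ (-α) * (Cx' - Cx))| := by
      rw [← abs_of_nonneg hW0, ← abs_mul, abs_of_nonneg hW0]; ring_nf
    rw [e1]
    have hA : |s ^ (-α) * (vX D cq x' - vX D cq x) * Cx'|
        ≤ (d + 1) * D1 hprof * (Q'' * EE) * (LJ ^ (1 - α) * (E5 * B)) := by
      rw [abs_mul, abs_mul, abs_of_nonneg hW0]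
      calc s ^ (-α) * |vX D cq x' - vX D cq x| * |Cx'|
          ≤ s ^ (-α) * ((d + 1) * D1 hprof * s / Nj) * (nn * Q'' * Real.exp (-(δ₅ * Dd / nn)) * B) :=
            mul_le_mul (mul_le_mul_of_nonneg_left hdv hW0) hcore' (abs_nonneg _) (by positivity)
        _ = (d + 1) * D1 hprof * Q'' * ((s ^ (-α) * s) * (nn / Nj)) * (Real.exp (-(δ₅ * Dd / nn)) * B) := by
            field_simp
        _ ≤ (d + 1) * D1 hprof * Q'' * (LJ ^ (1 - α) * 1) * ((EE * E5) * B) := by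
            refine mul_le_mul (mul_le_mul_of_nonneg_left (mul_le_mul hWs hnNj' (by positivity) hLJα0)
              (by positivity)) (mul_le_mul_of_nonneg_right hexp hB0) (by positivity) (by positivity)
        _ = (d + 1) * D1 hprof * (Q'' * EE) * (LJ ^ (1 - α) * (E5 * B)) := by ring
    have hBterm : |vX D cq x * (s ^ (-α) * (Cx' - Cx))| ≤ Qp * (LJ ^ (1 - α) * (E5 * B)) := by
      rw [abs_mul]
      have hp' : |s ^ (-α) * (Cx' - Cx)|
          ≤ ((d + 1) * ((d + 1) * D1 hprof) * EE * cd * (s ^ (-α) * s) * (nn / Nj) + nn ^ (1 - α) * cH)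
            * Real.exp (-(δ₅ * Dd / nn)) * B := by
        rw [abs_mul, abs_of_nonneg hW0]; exact hpair
      have hcd0 := hcd.le
      have hcH0 := hcH.le
      calc |vX D cq x| * |s ^ (-α) * (Cx' - Cx)|
          ≤ 1 * (((d + 1) * ((d + 1) * D1 hprof) * EE * cd * (s ^ (-α) * s) * (nn / Nj) + nn ^ (1 - α) * cH)
              * Real.exp (-(δ₅ * Dd / nn)) * B) := mul_le_mul hvx hp' (abs_nonneg _) zero_le_one
        _ ≤ 1 * (((d + 1) * ((d + 1) * D1 hprof) * EE * cd * (LJ ^ (1 - α) * 1) + LJ ^ (1 - α) * cH)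
              * (EE * E5) * B) := by
            refine mul_le_mul_of_nonneg_left ?_ zero_le_one
            have hC0 : 0 ≤ (d + 1) * ((d + 1) * D1 hprof) * EE * cd := by positivity
            have h1 : (d + 1) * ((d + 1) * D1 hprof) * EE * cd * (s ^ (-α) * s) * (nn / Nj)
                ≤ (d + 1) * ((d + 1) * D1 hprof) * EE * cd * (LJ ^ (1 - α) * 1) := by
              rw [mul_assoc ((d + 1) * ((d + 1) * D1 hprof) * EE * cd)]
              exact mul_le_mul_of_nonneg_left (mul_le_mul hWs hnNj' (by positivity) hLJα0) hC0
            refine mul_le_mul (mul_le_mul (add_le_add h1 (mul_le_mul_of_nonneg_right hnα hcH0)) hexp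
              (by positivity) (by positivity)) le_rfl hB0 (by positivity)
        _ = Qp * (LJ ^ (1 - α) * (E5 * B)) := by rw [hQp]; ring
    calc |s ^ (-α) * (vX D cq x' - vX D cq x) * Cx' + vX D cq x * (s ^ (-α) * (Cx' - Cx))|
        ≤ (d + 1) * D1 hprof * (Q'' * EE) * (LJ ^ (1 - α) * (E5 * B)) + Qp * (LJ ^ (1 - α) * (E5 * B)) :=
          (abs_add_le _ _).trans (add_le_add hA hBterm)
      _ = LJ ^ (1 - α) * (((d + 1) * D1 hprof * (Q'' * EE) + Qp) * E5 * B) := by ring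
      _ ≤ LJ ^ (1 - α)
          * (((d + 1) * D1 hprof * (Q'' * EE) + Qp + 2 * ((ℓ : ℝ) + 1) * (Q'' * EE) + 1) * E5 * B) := by
          refine mul_le_mul_of_nonneg_left (mul_le_mul_of_nonneg_right (mul_le_mul_of_nonneg_right ?_ hE50) hB0)
            hLJα0
          have : 0 ≤ 2 * ((ℓ : ℝ) + 1) * (Q'' * EE) := by positivity
          linarith
  · -- FAR PAIRS: two single rows
    have hns : nn ≤ s := by push Not at hnear; linarith
    have hWL : s ^ (-α) * LJ ≤ ((ℓ : ℝ) + 1) * LJ ^ (1 - α) := rpow_far_le hn0 hns hLJ0 hT hL1 hα0 hα1.le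
    have hWn : s ^ (-α) * nn ≤ ((ℓ : ℝ) + 1) * LJ ^ (1 - α) := (mul_le_mul_of_nonneg_left hnLJ hW0).trans hWL
    calc s ^ (-α) * |(((aX D a c hP cq hc)ᵀ * (dMat (N0 ℓ Mh k P) μ)ᵀ) *ᵥ lam) x'
            - (((aX D a c hP cq hc)ᵀ * (dMat (N0 ℓ Mh k P) μ)ᵀ) *ᵥ lam) x|
        ≤ s ^ (-α) * (nn * Q'' * EE * E5 * B + nn * Q'' * EE * E5 * B) :=
          mul_le_mul_of_nonneg_left ((abs_sub _ _).trans (add_le_add hrowx' hrowx)) hW0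
      _ = (s ^ (-α) * nn) * (2 * (Q'' * EE) * E5 * B) := by ring
      _ ≤ (((ℓ : ℝ) + 1) * LJ ^ (1 - α)) * (2 * (Q'' * EE) * E5 * B) :=
          mul_le_mul_of_nonneg_right hWn (by positivity)
      _ = LJ ^ (1 - α) * ((2 * ((ℓ : ℝ) + 1) * (Q'' * EE)) * E5 * B) := by ring
      _ ≤ LJ ^ (1 - α)
          * (((d + 1) * D1 hprof * (Q'' * EE) + Qp + 2 * ((ℓ : ℝ) + 1) * (Q'' * EE) + 1) * E5 * B) := by
          refine mul_le_mul_of_nonneg_left (mul_le_mul_of_nonneg_right (mul_le_mul_of_nonneg_right ?_ hE50) hB0)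
            hLJα0
          have : 0 ≤ (d + 1) * D1 hprof * (Q'' * EE) := by positivity
          linarith

end RowPair

/-! ## §2 One term of `Rᵀ` on the level-weighted input over a pair of columns of one block, rate uniform in `α` -/

section ColPair

variable {ℓ Mh k R : ℕ} {P : Fin (d + 1) → ℕ} {D : Domains d ℓ Mh k P R} {a c : ℕ → ℝ}

set_option maxHeartbeats 1600000 in
/-- **ONE TERM OF `Rᵀ` ON THE LEVEL-WEIGHTED INPUT OVER A PAIR OF COLUMNS IN ONE BLOCK, RATE UNIFORM IN `α`** — p21's
`B6DualHolderTermMultiLevelBox.bXt_dd_le` in print's quantifier order `∃ δ₆ ∀ α ∈ [0,1) ∃ Q(α)`: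
`|x̂−x|_∞^{−α}·|((K_□(h_□)G′(□)v_□)ᵀ(Λf))(x̂) − (…)(x)| ≤ (L^{j})^{1−α}·(Q/M_h)·e^{−δ₆d(y,y′)/(d+1)}·sup|f|` for `x ≠ x̂` in
one `j`-block `y` and `f` supported in the block `y′`; the rate `δ₆ = min(δ(2.43)₁, δ(2.43)∂*, δ(2.43)₂, δ_H, δ₇)` is
`α`-free (`δ₇` from the `α`-free `bXt_col_le`).  Proof = the original (near pairs by `bXt_pair_near_le` with
`κ, κ₁ = O(M^{−1})`, `κ₂ = O(M^{−2})`, far pairs by two single columns) with the `∃`-witnesses reordered.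
[cite: Balaban1984PropagatorsII, Proposition 2.2 (2.67) p.234 (fifth entry), (2.44) p.230, (2.49)/(2.51) p.232; Balaban1983RegularityDecay, Theorem (1.9) p.573] -/
theorem bXt_dd_le_unif (d ℓ : ℕ) (hℓ : 1 ≤ ℓ) (aminus aplus a2minus a2plus : ℝ) (ha : 0 < aminus)
    (ha2 : 0 < a2minus) :
    ∃ δ₆ : ℝ, 0 < δ₆ ∧ ∀ (α : ℝ), 0 ≤ α → α < 1 → ∃ Q : ℝ, 0 < Q ∧ ∀ (k Mh R : ℕ), 3 ≤ Mh → 2 * (ℓ + 1) ≤ R →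
      ∀ (P : Fin (d + 1) → ℕ) (hP : ∀ μ, 1 ≤ P μ) (D : Domains d ℓ Mh k P R) (a c : ℕ → ℝ),
        (∀ i, 1 ≤ i → aminus ≤ a i ∧ a i ≤ aplus) → (∀ i, 1 ≤ i → a2minus ≤ c i ∧ c i ≤ a2plus) →
        ∀ (y' : ↥(bset D)) (f : ↥(boxDom (N0 ℓ Mh k P)) → ℝ) (B : ℝ),
          BlockSupp (g := geom D) (blkOf D) f y' B →
          ∀ (x x' : ↥(boxDom (N0 ℓ Mh k P))), x'.1 ≠ x.1 → blkOf D x' = blkOf D x →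
          ∀ (cq : ℕ × (Fin (d + 1) → ℤ)) (hc : CubeData D cq),
            (supNorm (x'.1 - x.1)) ^ (-α)
                * |((bX D a c hP cq hc)ᵀ *ᵥ (levW D 1 *ᵥ f)) x' - ((bX D a c hP cq hc)ᵀ *ᵥ (levW D 1 *ᵥ f)) x|
              ≤ (((ℓ : ℝ) + 1) ^ D.lev x.1) ^ (1 - α)
                * (Q / Mh * Real.exp (-(δ₆ / (d + 1) * (geom D).dist (blkOf D x) y')) * B) := by
  obtain ⟨δa, c', hδa, hc', h243⟩ := ineq243_twoLevel_roww d ℓ hℓ aminus aplus 0 a2minus a2plus ha ha2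
  obtain ⟨δs, cs, hδs, hcs, h243s⟩ := ineq243_twoLevel_dstar_roww d ℓ hℓ aminus aplus 0 a2minus a2plus ha ha2
  obtain ⟨δd, cd, hδd, hcd, h243d⟩ := ineq243_twoLevel_deriv_wsum d ℓ hℓ aminus aplus 0 a2minus a2plus ha ha2
  obtain ⟨δH, hδH, hHA⟩ := ineq243_twoLevel_holderDual_wsum2_unif d ℓ hℓ aminus aplus 0 a2minus a2plus ha ha2
  obtain ⟨δ₇, K₇, hδ₇, hK₇, hcol⟩ := bXt_col_le d ℓ hℓ aminus aplus a2minus a2plus ha ha2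
  have hD1 := D1_nonneg contDiff_hprof hasCompactSupport_hprof
  have hD2 := D2_nonneg contDiff_hprof hasCompactSupport_hprof
  obtain ⟨δ, hδdef⟩ : ∃ t : ℝ, t = min (min δa δs) (min δd δH) := ⟨_, rfl⟩
  have hδpos : 0 < δ := by rw [hδdef]; exact lt_min (lt_min hδa hδs) (lt_min hδd hδH)
  have h1a : δ ≤ δa := by rw [hδdef]; exact (min_le_left _ _).trans (min_le_left _ _)
  have h1s : δ ≤ δs := by rw [hδdef]; exact (min_le_left _ _).trans (min_le_right _ _)
  have h1d : δ ≤ δd := by rw [hδdef]; exact (min_le_right _ _).trans (min_le_left _ _)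
  have h1H : δ ≤ δH := by rw [hδdef]; exact (min_le_right _ _).trans (min_le_right _ _)
  obtain ⟨δ₆, hδ₆⟩ : ∃ t : ℝ, t = min δ δ₇ := ⟨_, rfl⟩
  have hδ₆pos : 0 < δ₆ := by rw [hδ₆]; exact lt_min hδpos hδ₇
  have h6δ : δ₆ ≤ δ := by rw [hδ₆]; exact min_le_left _ _
  have h67 : δ₆ ≤ δ₇ := by rw [hδ₆]; exact min_le_right _ _
  have hL0 : (0 : ℝ) < (ℓ : ℝ) + 1 := by positivity
  have hL1 : (1 : ℝ) ≤ (ℓ : ℝ) + 1 := by linarith [(Nat.cast_nonneg ℓ : (0 : ℝ) ≤ ℓ)]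
  -- the `M`-free constants
  obtain ⟨A₁, hA₁⟩ : ∃ A₁ : ℝ, A₁ = (d + 1) * D1 hprof := ⟨_, rfl⟩
  obtain ⟨A₂, hA₂⟩ : ∃ A₂ : ℝ, A₂ = (d + 1) * D2 hprof := ⟨_, rfl⟩
  obtain ⟨ap, hap⟩ : ∃ ap : ℝ, ap = (|aplus| + |a2plus|) * ((ℓ : ℝ) + 1) * Real.exp (δ * ((ℓ : ℝ) + 1)) :=
    ⟨_, rfl⟩
  have hA₁0 : 0 ≤ A₁ := by rw [hA₁]; positivity
  have hA₂0 : 0 ≤ A₂ := by rw [hA₂]; positivity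
  have hap0 : 0 ≤ ap := by rw [hap]; positivity
  obtain ⟨EE, hEE⟩ : ∃ t : ℝ, t = Real.exp δ * Real.exp δ := ⟨_, rfl⟩
  have hEE0 : 0 ≤ EE := by rw [hEE]; positivity
  have hcs0 := hcs.le
  have hc'0 := hc'.le
  have hcd0 := hcd.le
  refine ⟨δ₆, hδ₆pos, fun α hα0 hα1 => ?_⟩
  obtain ⟨cH, hcH, hH⟩ := hHA α hα0 hα1
  have hcH0 := hcH.le
  obtain ⟨CP, hCP⟩ : ∃ t : ℝ, t = A₁ * (1 + Real.exp δ) * ((d + 1) * (A₁ * cs + cH))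
      + (A₂ + ap * A₁) * (A₁ * c' + (2 * c' + ((d : ℝ) + 1) * Real.exp δ * cd)) := ⟨_, rfl⟩
  have hCP0 : 0 ≤ CP := by rw [hCP]; positivity
  refine ⟨((ℓ : ℝ) + 1) ^ 2 * EE * CP + 2 * ((ℓ : ℝ) + 1) ^ 2 * K₇ + 1, by positivity, ?_⟩
  intro k Mh R hMh hR P hP D a c haw hcw y' lam B hlam x x' hne hblk cq hc
  obtain ⟨hi1, hij, hji, -, -⟩ := fin_data hc
  have hjk := hc.hj.2
  have hMh1 : 1 ≤ Mh := le_trans (by norm_num) hMh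
  have hMhr : (1 : ℝ) ≤ Mh := by exact_mod_cast hMh1
  have hMh0 : (0 : ℝ) < Mh := by linarith
  have hB0 : 0 ≤ B := hlam.nonneg
  have hlamB : ∀ w, |lam w| ≤ B := fun w => BlockSupp.abs_le hlam w
  obtain ⟨dist0, hdist0⟩ : ∃ t : ℝ, t = (((bond D).dist (blkOf D x) y' : ℕ) : ℝ) := ⟨_, rfl⟩
  have hgeom : (geom D).dist (blkOf D x) y' = dist0 := by rw [hdist0]; rfl
  have hgeom' : (geom D).dist (blkOf D x') y' = dist0 := by rw [hblk, hgeom]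
  have hdist0nn : 0 ≤ dist0 := by rw [hdist0]; positivity
  rw [hgeom]
  obtain ⟨E6, hE6⟩ : ∃ t : ℝ, t = Real.exp (-(δ₆ / (d + 1) * dist0)) := ⟨_, rfl⟩
  rw [← hE6]
  have hE60 : 0 ≤ E6 := by rw [hE6]; exact (Real.exp_pos _).le
  have hE7 : Real.exp (-(δ₇ / (d + 1) * dist0)) ≤ E6 := by rw [hE6]; exact exp_rate_mono h67 hdist0nn d
  obtain ⟨LJ, hLJ⟩ : ∃ t : ℝ, t = ((ℓ : ℝ) + 1) ^ D.lev x.1 := ⟨_, rfl⟩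
  have hLJ0 : 0 < LJ := by rw [hLJ]; positivity
  have hLJα0 : 0 ≤ LJ ^ (1 - α) := Real.rpow_nonneg hLJ0.le _
  have hLJ1 : ((ℓ : ℝ) + 1) ^ (D.lev x.1 + 1) = ((ℓ : ℝ) + 1) * LJ := by rw [hLJ, pow_succ']
  have hRHS0 : 0 ≤ LJ ^ (1 - α)
      * ((((ℓ : ℝ) + 1) ^ 2 * EE * CP + 2 * ((ℓ : ℝ) + 1) ^ 2 * K₇ + 1) / Mh * E6 * B) := by positivity
  obtain ⟨s, hs⟩ : ∃ t : ℝ, t = supNorm (x'.1 - x.1) := ⟨_, rfl⟩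
  have hs1 : 1 ≤ s := by rw [hs]; exact B4StripSumsHolder.one_le_supNorm (sub_ne_zero.2 hne)
  have hs0 : 0 < s := lt_of_lt_of_le one_pos hs1
  have hW0 : 0 ≤ s ^ (-α) := Real.rpow_nonneg hs0.le _
  obtain ⟨g, hgdef⟩ : ∃ t : ↥(boxDom (N0 ℓ Mh k P)) → ℝ, t = levW D 1 *ᵥ lam := ⟨_, rfl⟩
  have hgz : ∀ z, g z = ((ℓ : ℝ) + 1) ^ D.lev z.1 * lam z := by
    intro z; rw [hgdef]; unfold levW; rw [Matrix.mulVec_diagonal, zpow_one]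
  have hcolx := hcol k Mh R hMh hR P hP D a c haw hcw y' lam B hlam x cq hc
  have hcolx' := hcol k Mh R hMh hR P hP D a c haw hcw y' lam B hlam x' cq hc
  rw [← hgdef, hgeom, hLJ1] at hcolx
  have hlevx' : D.lev x'.1 = D.lev x.1 := congrArg (fun s : ↥(bset D) => s.1.1) hblk
  rw [← hgdef, hgeom', hlevx', hLJ1] at hcolx'
  rw [← hgdef, ← hLJ, ← hs]
  -- the trivial case
  by_cases h0 : uX (ℓ := ℓ) (Mh := Mh) (k := k) (P := P) cq x = 0 ∧ uX (ℓ := ℓ) (Mh := Mh) (k := k) (P := P) cq x' = 0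
  · rw [bXt_col_eq_zero_of_uX (D := D) (a := a) (c := c) hP cq hc g h0.1,
      bXt_col_eq_zero_of_uX (D := D) (a := a) (c := c) hP cq hc g h0.2]
    simp only [sub_self, abs_zero, mul_zero]
    exact hRHS0
  have hu : uX (ℓ := ℓ) (Mh := Mh) (k := k) (P := P) cq x ≠ 0 ∨ uX (ℓ := ℓ) (Mh := Mh) (k := k) (P := P) cq x' ≠ 0 := by
    by_contra h'; push Not at h'; exact h0 ⟨h'.1, h'.2⟩
  -- the level window at `x`
  have hzval : ∀ w : ↥(boxDom (N0 ℓ Mh k P)), ((castP (ℓ := ℓ) (Mh := Mh) (P := P) hij hjk).symm w).1 = w.1 :=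
    fun w => by unfold castP; exact boxCast_symm_apply_val _ _
  have hinc : ∀ (w : ↥(boxDom (N0 ℓ Mh k P))) (bw : ↥(Box d ℓ (fin D cq.1 cq.2)
      (fun ν => (ℓ + 1) * cubeM' (MhP ℓ Mh cq.1 (fin D cq.1 cq.2)) (Pj ℓ k P cq.1) cq.2 ν))),
      embC D hP cq hc bw = (castP (ℓ := ℓ) (Mh := Mh) (P := P) hij hjk).symm w → InCube ℓ Mh k P cq.1 cq.2 w.1 :=
    fun w bw hbw => by rw [← hzval w]; exact (inCube_iff_exists_emb (Mh := Mh) hP hij hc.hq _).2 ⟨bw, hbw⟩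
  have hwin : fin D cq.1 cq.2 ≤ D.lev x.1 ∧ D.lev x.1 ≤ fin D cq.1 cq.2 + 1 := by
    rcases hu with h | h
    · obtain ⟨bw, hbw⟩ := img_of_uX_ne_zero hℓ hP hMh1 cq hc h (Or.inr rfl)
      exact lev_window_of_inCube hℓ hR hP hMh1 hc x.2 (hinc x bw hbw)
    · obtain ⟨bw, hbw⟩ := img_of_uX_ne_zero hℓ hP hMh1 cq hc h (Or.inr rfl)
      rw [← hlevx']; exact lev_window_of_inCube hℓ hR hP hMh1 hc x'.2 (hinc x' bw hbw)
  obtain ⟨nn, hnn⟩ : ∃ t : ℝ, t = (((ℓ + 1) ^ fin D cq.1 cq.2 : ℕ) : ℝ) := ⟨_, rfl⟩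
  have hncast : nn = ((ℓ : ℝ) + 1) ^ fin D cq.1 cq.2 := by rw [hnn]; push_cast; ring
  have hn1' : 1 ≤ (ℓ + 1) ^ fin D cq.1 cq.2 := Nat.one_le_pow _ _ (by omega)
  have hn1 : (1 : ℝ) ≤ nn := by rw [hnn]; exact_mod_cast hn1'
  have hn0 : (0 : ℝ) < nn := lt_of_lt_of_le one_pos hn1
  have hnLJ : nn ≤ LJ := by rw [hncast, hLJ]; exact pow_le_pow_right₀ hL1 hwin.1
  have hT : LJ ≤ ((ℓ : ℝ) + 1) * nn := by
    rw [hLJ, hncast, ← pow_succ']; exact pow_le_pow_right₀ hL1 hwin.2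
  obtain ⟨Nj, hNj⟩ : ∃ t : ℝ, t = (((ℓ + 1) ^ cq.1 : ℕ) : ℝ) := ⟨_, rfl⟩
  have hNj1' : 1 ≤ (ℓ + 1) ^ cq.1 := Nat.one_le_pow _ _ (by omega)
  have hNj0 : 0 < Nj := by rw [hNj]; exact_mod_cast hNj1'
  have hnNj : nn ≤ Nj := by
    rw [hnn, hNj]; exact_mod_cast Nat.pow_le_pow_right (by omega) hij
  obtain ⟨M, hM⟩ : ∃ M : ℝ, M = ((ℓ : ℝ) + 1) * Mh := ⟨_, rfl⟩
  have hM1 : (1 : ℝ) ≤ M := by rw [hM]; nlinarith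
  have hMpos : 0 < M := by linarith
  have hMhM : (Mh : ℝ) ≤ M := by rw [hM]; nlinarith
  have hM1n : 1 ≤ (ℓ + 1) * Mh := Nat.one_le_iff_ne_zero.2 (Nat.mul_ne_zero_iff.2 ⟨by omega, by omega⟩)
  have hMc : (((ℓ + 1) * Mh : ℕ) : ℝ) = M := by rw [hM]; push_cast; ring
  -- the Hölder weights of both regimes: `w^{−α}·L^{j+1} ≤ L²(L^j)^{1−α}` for `n ≤ w`
  have hfarW : ∀ w : ℝ, nn ≤ w → w ^ (-α) * (((ℓ : ℝ) + 1) * LJ) ≤ ((ℓ : ℝ) + 1) ^ 2 * LJ ^ (1 - α) := by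
    intro w hw
    have h := rpow_far_le hn0 hw hLJ0 hT hL1 hα0 hα1.le
    calc w ^ (-α) * (((ℓ : ℝ) + 1) * LJ) = ((ℓ : ℝ) + 1) * (w ^ (-α) * LJ) := by ring
      _ ≤ ((ℓ : ℝ) + 1) * (((ℓ : ℝ) + 1) * LJ ^ (1 - α)) := mul_le_mul_of_nonneg_left h hL0.le
      _ = ((ℓ : ℝ) + 1) ^ 2 * LJ ^ (1 - α) := by ring
  have hQ1 : ((ℓ : ℝ) + 1) ^ 2 * EE * CP ≤ ((ℓ : ℝ) + 1) ^ 2 * EE * CP + 2 * ((ℓ : ℝ) + 1) ^ 2 * K₇ + 1 := by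
    have : 0 ≤ 2 * ((ℓ : ℝ) + 1) ^ 2 * K₇ := by positivity
    linarith
  have hQ2 : 2 * ((ℓ : ℝ) + 1) ^ 2 * K₇ ≤ ((ℓ : ℝ) + 1) ^ 2 * EE * CP + 2 * ((ℓ : ℝ) + 1) ^ 2 * K₇ + 1 := by
    have : 0 ≤ ((ℓ : ℝ) + 1) ^ 2 * EE * CP := by positivity
    linarith
  by_cases hnear : s ≤ nn
  · -- NEAR PAIRS: both points lie in the cube image
    obtain ⟨b, b', hb, hb'⟩ : ∃ b b', embC D hP cq hc b = (castP (ℓ := ℓ) (Mh := Mh) (P := P) hij hjk).symm x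
        ∧ embC D hP cq hc b' = (castP (ℓ := ℓ) (Mh := Mh) (P := P) hij hjk).symm x' := by
      have hd1 : supNorm (x'.1 - x.1) ≤ 2 * (((ℓ + 1) ^ fin D cq.1 cq.2 : ℕ) : ℝ) := by
        rw [← hs, ← hnn]; linarith only [hnear, hn0]
      have hd2 : supNorm (x.1 - x'.1) ≤ 2 * (((ℓ + 1) ^ fin D cq.1 cq.2 : ℕ) : ℝ) := by
        rw [supNorm_sub_comm]; exact hd1
      have hd0 : ∀ w : ↥(boxDom (N0 ℓ Mh k P)), supNorm (w.1 - w.1) ≤ 2 * (((ℓ + 1) ^ fin D cq.1 cq.2 : ℕ) : ℝ) := by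
        intro w
        have h0' : supNorm (w.1 - w.1) = 0 := by rw [sub_self]; unfold B4ContourShift.supNorm; simp
        rw [h0']; positivity
      rcases hu with h | h
      · obtain ⟨b, hb⟩ := img_of_near hℓ hP hMh cq hc h (hd0 x)
        obtain ⟨b', hb'⟩ := img_of_near hℓ hP hMh cq hc h hd1
        exact ⟨b, b', hb, hb'⟩
      · obtain ⟨b, hb⟩ := img_of_near hℓ hP hMh cq hc h hd2
        obtain ⟨b', hb'⟩ := img_of_near hℓ hP hMh cq hc h (hd0 x')
        exact ⟨b, b', hb, hb'⟩
    have hbx : (embC D hP cq hc b).1 = x.1 := by rw [hb, hzval]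
    have hb'x : (embC D hP cq hc b').1 = x'.1 := by rw [hb', hzval]
    have hsubE : ∀ u v, (embC D hP cq hc u).1 - (embC D hP cq hc v).1 = u.1 - v.1 := fun u v => by
      unfold embC; exact emb_sub_emb _ hc.hq u v
    have hb'b : b'.1 - b.1 = x'.1 - x.1 := by rw [← hsubE b' b, hb'x, hbx]
    have hsb : supNorm (b'.1 - b.1) = s := by rw [hb'b, hs]
    have hneb : b'.1 ≠ b.1 := fun h => hne (by
      have := hb'b; rw [h, sub_self] at this; exact (sub_eq_zero.1 this.symm))
    have hxin : InCube ℓ Mh k P cq.1 cq.2 x.1 := hinc x b hb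
    have hx'in : InCube ℓ Mh k P cq.1 cq.2 x'.1 := hinc x' b' hb'
    -- the per-cube inputs
    have hMh' : 1 ≤ MhP ℓ Mh cq.1 (fin D cq.1 cq.2) := one_le_MhP hMh1 _ _
    have hMhle : Mh ≤ MhP ℓ Mh cq.1 (fin D cq.1 cq.2) := by
      unfold MhP; exact Nat.le_mul_of_pos_right _ (Nat.one_le_pow _ _ (by omega))
    have hcM' : ∀ ν, 1 ≤ cubeM' (MhP ℓ Mh cq.1 (fin D cq.1 cq.2)) (Pj ℓ k P cq.1) cq.2 ν := fun ν =>
      Nat.one_le_iff_ne_zero.2 (Nat.mul_ne_zero_iff.2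
        ⟨by omega, by have := (one_le_cubeW (one_le_Pj hP cq.1) hc.hq ν).1; omega⟩)
    have haj : 0 < a (fin D cq.1 cq.2) := lt_of_lt_of_le ha (haw _ hi1).1
    have hc0 : 0 ≤ c (fin D cq.1 cq.2) := (lt_of_lt_of_le ha2 (hcw _ hi1).1).le
    obtain ⟨M', hM'⟩ : ∃ M' : ℝ, M' = ((ℓ : ℝ) + 1) * (MhP ℓ Mh cq.1 (fin D cq.1 cq.2) : ℝ) := ⟨_, rfl⟩
    have hMM' : M ≤ M' := by
      rw [hM, hM']; exact mul_le_mul_of_nonneg_left (by exact_mod_cast hMhle) hL0.le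
    have hM'pos : 0 < M' := lt_of_lt_of_le hMpos hMM'
    obtain ⟨κ₁, hκ₁⟩ : ∃ κ₁ : ℝ, κ₁ = A₁ / M' := ⟨_, rfl⟩
    obtain ⟨κ₂, hκ₂⟩ : ∃ κ₂ : ℝ, κ₂ = (d + 1) * (D2 hprof / M' ^ 2) := ⟨_, rfl⟩
    obtain ⟨κ, hκ⟩ : ∃ κ : ℝ, κ = A₁ / M := ⟨_, rfl⟩
    have hκ₁0 : 0 ≤ κ₁ := by rw [hκ₁]; positivity
    have hκ₂0 : 0 ≤ κ₂ := by rw [hκ₂]; positivity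
    have hκ0 : 0 ≤ κ := by rw [hκ]; positivity
    have hG : ∀ w, roww δ ((ℓ + 1) ^ fin D cq.1 cq.2) (cG D a c cq.1 (fin D cq.1 cq.2) cq.2 hP hc.hq) w ≤ c' :=
      fun w => (roww_mono h1a _ _ _).trans (h243 (fin D cq.1 cq.2) hi1 (a (fin D cq.1 cq.2)) 0 (c (fin D cq.1 cq.2))
        (haw _ hi1).1 (haw _ hi1).2 le_rfl le_rfl (hcw _ hi1).1 (hcw _ hi1).2 _ hcM' _ w)
    have hGs : ∀ (μ : Fin (d + 1)) w, roww δ ((ℓ + 1) ^ fin D cq.1 cq.2)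
        (dstar ((ℓ + 1) ^ fin D cq.1 cq.2) μ (cG D a c cq.1 (fin D cq.1 cq.2) cq.2 hP hc.hq)) w ≤ cs :=
      fun μ w => (roww_mono h1s _ _ _).trans (h243s (fin D cq.1 cq.2) hi1 (a (fin D cq.1 cq.2)) 0
        (c (fin D cq.1 cq.2)) (haw _ hi1).1 (haw _ hi1).2 le_rfl le_rfl (hcw _ hi1).1 (hcw _ hi1).2 _ hcM'
        (lamLoc ℓ (MhP ℓ Mh cq.1 (fin D cq.1 cq.2)) (Pj ℓ k P cq.1) cq.2 (one_le_Pj hP cq.1) hc.hq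
          (LamG D cq.1 (fin D cq.1 cq.2))) μ w)
    have hGd : ∀ (i : Fin (d + 1)) (v ve : ↥(Box d ℓ (fin D cq.1 cq.2)
        (fun ν => (ℓ + 1) * cubeM' (MhP ℓ Mh cq.1 (fin D cq.1 cq.2)) (Pj ℓ k P cq.1) cq.2 ν))),
        ve.1 = v.1 + Pi.single i 1 →
        wsum δ ((ℓ + 1) ^ fin D cq.1 cq.2) v (fun z => (((ℓ + 1) ^ fin D cq.1 cq.2 : ℕ) : ℝ)
          * (cG D a c cq.1 (fin D cq.1 cq.2) cq.2 hP hc.hq ve z - cG D a c cq.1 (fin D cq.1 cq.2) cq.2 hP hc.hq v z))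
          ≤ cd :=
      fun i v ve hve => (wsum_mono_rate h1d _ _ _).trans (h243d (fin D cq.1 cq.2) hi1 (a (fin D cq.1 cq.2)) 0
        (c (fin D cq.1 cq.2)) (haw _ hi1).1 (haw _ hi1).2 le_rfl le_rfl (hcw _ hi1).1 (hcw _ hi1).2 _ hcM' _ i
        v ve hve)
    have hTT : ∀ μ : Fin (d + 1), wsum2 δ ((ℓ + 1) ^ fin D cq.1 cq.2) b b' (fun w =>
        ((((ℓ + 1) ^ fin D cq.1 cq.2 : ℕ) : ℝ) / supNorm (b'.1 - b.1)) ^ α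
          * ((((ℓ + 1) ^ fin D cq.1 cq.2 : ℕ) : ℝ)
            * ((cG D a c cq.1 (fin D cq.1 cq.2) cq.2 hP hc.hq b' (fwd _ μ w)
                - cG D a c cq.1 (fin D cq.1 cq.2) cq.2 hP hc.hq b' w)
              - (cG D a c cq.1 (fin D cq.1 cq.2) cq.2 hP hc.hq b (fwd _ μ w)
                - cG D a c cq.1 (fin D cq.1 cq.2) cq.2 hP hc.hq b w)))) ≤ cH :=
      fun μ => (wsum2_mono_rate h1H _ _ _ _).trans (hH (fin D cq.1 cq.2) hi1 (a (fin D cq.1 cq.2)) 0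
        (c (fin D cq.1 cq.2)) (haw _ hi1).1 (haw _ hi1).2 le_rfl le_rfl (hcw _ hi1).1 (hcw _ hi1).2 _ hcM' _ μ
        b b' hneb)
    -- the input vector on the cube image: bound and support distances
    have hgG : ∀ z, |g (castP (fin_data hc).2.1 hc.hj.2 (embC D hP cq hc z))| ≤ ((ℓ : ℝ) + 1) * LJ * B := by
      intro z
      rw [hgz, abs_mul, abs_of_nonneg (by positivity)]
      set x'' : ↥(boxDom (N0 ℓ Mh k P)) := castP (fin_data hc).2.1 hc.hj.2 (embC D hP cq hc z) with hx''
      have hx''val : x''.1 = (embC D hP cq hc z).1 := by rw [hx'']; unfold castP; exact boxCast_apply_val _ _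
      have hx''in : InCube ℓ Mh k P cq.1 cq.2 x''.1 := by
        rw [hx''val]; exact (inCube_iff_exists_emb (Mh := Mh) hP hij hc.hq _).2 ⟨z, rfl⟩
      have hlev'' := lev_window_of_inCube hℓ hR hP hMh1 hc x''.2 hx''in
      have hpow : ((ℓ : ℝ) + 1) ^ D.lev x''.1 ≤ ((ℓ : ℝ) + 1) * LJ := by
        rw [← hLJ1]; exact pow_le_pow_right₀ hL1 (by omega)
      exact mul_le_mul hpow (hlamB _) (abs_nonneg _) (by positivity)
    obtain ⟨Dd, hDd⟩ : ∃ t : ℝ, t = nn * (dist0 / (d + 1) - 1) := ⟨_, rfl⟩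
    have hDgen : ∀ (w : ↥(boxDom (N0 ℓ Mh k P))) (bw : ↥(Box d ℓ (fin D cq.1 cq.2)
        (fun ν => (ℓ + 1) * cubeM' (MhP ℓ Mh cq.1 (fin D cq.1 cq.2)) (Pj ℓ k P cq.1) cq.2 ν))),
        (embC D hP cq hc bw).1 = w.1 → InCube ℓ Mh k P cq.1 cq.2 w.1 → (geom D).dist (blkOf D w) y' = dist0 →
        ∀ z, g (castP (fin_data hc).2.1 hc.hj.2 (embC D hP cq hc z)) ≠ 0 → Dd ≤ supNorm (bw.1 - z.1) := by
      intro w bw hbw hwin' hwd z hz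
      set x'' : ↥(boxDom (N0 ℓ Mh k P)) := castP (fin_data hc).2.1 hc.hj.2 (embC D hP cq hc z) with hx''
      have hμx : lam x'' ≠ 0 := by
        intro h0'; apply hz; rw [hgz, h0', mul_zero]
      have hx''val : x''.1 = (embC D hP cq hc z).1 := by
        rw [hx'']; unfold castP; exact boxCast_apply_val _ _
      have hx''in : InCube ℓ Mh k P cq.1 cq.2 x''.1 := by
        rw [hx''val]
        exact (inCube_iff_exists_emb (Mh := Mh) hP hij hc.hq _).2 ⟨z, rfl⟩
      have hblk'' : blkOf D x'' = y' := by
        by_contra hne'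
        exact hμx (hlam.off x'' hne')
      have h := Dd_le_supNorm hℓ hR hP hMh1 hc w x'' hwin' hx''in y' hblk''
      have hsub : w.1 - x''.1 = bw.1 - z.1 := by rw [hx''val, ← hbw]; exact hsubE bw z
      rw [hsub] at h
      have hd' : (((bond D).dist (blkOf D w) y' : ℕ) : ℝ) = dist0 := hwd
      rw [hd', ← hnn, ← hDd] at h
      exact h
    have hD_b := hDgen x b hbx hxin hgeom
    have hD_b' := hDgen x' b' hb'x hx'in hgeom'
    -- the jump of the cut-off between the two columns
    have htt : |vX D cq x' - vX D cq x| ≤ κ * supNorm (b'.1 - b.1) / (((ℓ + 1) ^ fin D cq.1 cq.2 : ℕ) : ℝ) := by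
      refine (abs_vX_sub_le (D := D) cq hlevx').trans ?_
      have h := abs_hq_sub_le (d := d) hNj1' hM1n cq.2 x.1 x'.1
      rw [← hNj, ← hs, hMc] at h
      rw [hsb, ← hnn, hκ, hA₁]
      refine h.trans ?_
      exact div_le_div_of_nonneg_left (by positivity) hn0 hnNj
    have key := bXt_pair_near_le (D := D) (a := a) (c := c) hP cq hc hα0 hα1.le hδpos.le hc'0 hcd0 hκ0 hκ₁0 hκ₂0
      haj hc0 hG hGd hGs
      (fun z z' => by rw [hκ₁, hA₁, hM']; exact hLoc_lipschitz hMh' cq.2 z z')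
      (fun z => by rw [hκ₂, hM']; exact hLoc_laplacian_le hℓ hi1 hMh' (one_le_Pj hP cq.1) hc.hq z)
      g (by positivity) hgG hb hb' hneb (by rw [hsb, ← hnn]; exact hnear) htt hTT hD_b hD_b'
    rw [hsb, ← hnn] at key
    -- sizes: `A ≤ C_P/M`, `e^{−δD/n} ≤ e^{2δ}E`, `n^{−α}L^{j+1} ≤ L²(L^j)^{1−α}`
    have hκ₁' : κ₁ ≤ A₁ / M := by rw [hκ₁]; exact div_le_div_of_nonneg_left hA₁0 hMpos hMM'
    have hκ' : κ ≤ A₁ := by rw [hκ]; exact div_le_self hA₁0 hM1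
    have hκ₂' : κ₂ ≤ A₂ / M := by
      rw [hκ₂, hA₂]
      have hM'1 : (1 : ℝ) ≤ M' := hM1.trans hMM'
      have hM2 : D2 hprof / M' ^ 2 ≤ D2 hprof / M := by
        apply div_le_div_of_nonneg_left hD2 hMpos
        calc M ≤ M' := hMM'
          _ = M' * 1 := (mul_one _).symm
          _ ≤ M' * M' := mul_le_mul_of_nonneg_left hM'1 hM'pos.le
          _ = M' ^ 2 := (sq _).symm
      calc ((d : ℝ) + 1) * (D2 hprof / M' ^ 2) ≤ (d + 1) * (D2 hprof / M) :=
            mul_le_mul_of_nonneg_left hM2 (by positivity)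
        _ = (d + 1) * D2 hprof / M := mul_div_assoc' _ _ _
    have hajp : (a (fin D cq.1 cq.2) + c (fin D cq.1 cq.2)) * ((ℓ : ℝ) + 1) * Real.exp (δ * ((ℓ : ℝ) + 1)) ≤ ap := by
      rw [hap]
      have : a (fin D cq.1 cq.2) + c (fin D cq.1 cq.2) ≤ |aplus| + |a2plus| :=
        add_le_add ((haw _ hi1).2.trans (le_abs_self _)) ((hcw _ hi1).2.trans (le_abs_self _))
      exact mul_le_mul_of_nonneg_right (mul_le_mul_of_nonneg_right this hL0.le) (Real.exp_pos _).le
    have hAle : κ₁ * (1 + Real.exp δ) * ((d + 1) * (κ * cs + cH))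
        + (κ₂ + (a (fin D cq.1 cq.2) + c (fin D cq.1 cq.2)) * ((ℓ : ℝ) + 1) * Real.exp (δ * ((ℓ : ℝ) + 1)) * κ₁)
          * (κ * c' + (2 * c' + ((d : ℝ) + 1) * Real.exp δ * cd)) ≤ CP / M := by
      have t1 : κ₁ * (1 + Real.exp δ) * ((d + 1) * (κ * cs + cH))
          ≤ A₁ / M * (1 + Real.exp δ) * ((d + 1) * (A₁ * cs + cH)) :=
        mul_le_mul (mul_le_mul_of_nonneg_right hκ₁' (by positivity))
          (mul_le_mul_of_nonneg_left (add_le_add (mul_le_mul_of_nonneg_right hκ' hcs0) le_rfl) (by positivity))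
          (by positivity) (by positivity)
      have t2 : (κ₂ + (a (fin D cq.1 cq.2) + c (fin D cq.1 cq.2)) * ((ℓ : ℝ) + 1) * Real.exp (δ * ((ℓ : ℝ) + 1)) * κ₁)
          * (κ * c' + (2 * c' + ((d : ℝ) + 1) * Real.exp δ * cd))
          ≤ (A₂ / M + ap * (A₁ / M)) * (A₁ * c' + (2 * c' + ((d : ℝ) + 1) * Real.exp δ * cd)) :=
        mul_le_mul (add_le_add hκ₂' (mul_le_mul hajp hκ₁' hκ₁0 hap0))
          (add_le_add (mul_le_mul_of_nonneg_right hκ' hc'0) le_rfl) (by positivity) (by positivity)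
      refine (add_le_add t1 t2).trans (le_of_eq ?_)
      rw [hCP]
      field_simp
    have hA0 : 0 ≤ κ₁ * (1 + Real.exp δ) * ((d + 1) * (κ * cs + cH))
        + (κ₂ + (a (fin D cq.1 cq.2) + c (fin D cq.1 cq.2)) * ((ℓ : ℝ) + 1) * Real.exp (δ * ((ℓ : ℝ) + 1)) * κ₁)
          * (κ * c' + (2 * c' + ((d : ℝ) + 1) * Real.exp δ * cd)) := by positivity
    have hexp : Real.exp (-(δ * Dd / nn)) ≤ EE * E6 := by
      rw [hDd, hEE, hE6]; exact exp_Dd_le hδpos.le h6δ hn1 hdist0nn d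
    have hnw := hfarW nn le_rfl
    calc s ^ (-α) * |((bX D a c hP cq hc)ᵀ *ᵥ g) x' - ((bX D a c hP cq hc)ᵀ *ᵥ g) x|
        ≤ nn ^ (-α) * (κ₁ * (1 + Real.exp δ) * ((d + 1) * (κ * cs + cH))
            + (κ₂ + (a (fin D cq.1 cq.2) + c (fin D cq.1 cq.2)) * ((ℓ : ℝ) + 1) * Real.exp (δ * ((ℓ : ℝ) + 1)) * κ₁)
              * (κ * c' + (2 * c' + ((d : ℝ) + 1) * Real.exp δ * cd)))
            * Real.exp (-(δ * Dd / nn)) * (((ℓ : ℝ) + 1) * LJ * B) := key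
      _ = (nn ^ (-α) * (((ℓ : ℝ) + 1) * LJ)) * (κ₁ * (1 + Real.exp δ) * ((d + 1) * (κ * cs + cH))
            + (κ₂ + (a (fin D cq.1 cq.2) + c (fin D cq.1 cq.2)) * ((ℓ : ℝ) + 1) * Real.exp (δ * ((ℓ : ℝ) + 1)) * κ₁)
              * (κ * c' + (2 * c' + ((d : ℝ) + 1) * Real.exp δ * cd)))
            * (Real.exp (-(δ * Dd / nn)) * B) := by ring
      _ ≤ (((ℓ : ℝ) + 1) ^ 2 * LJ ^ (1 - α)) * (CP / M) * ((EE * E6) * B) :=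
          mul_le_mul (mul_le_mul hnw hAle hA0 (by positivity)) (mul_le_mul_of_nonneg_right hexp hB0)
            (by positivity) (by positivity)
      _ = LJ ^ (1 - α) * ((((ℓ : ℝ) + 1) ^ 2 * EE * CP) / M * E6 * B) := by ring
      _ ≤ LJ ^ (1 - α) * ((((ℓ : ℝ) + 1) ^ 2 * EE * CP) / Mh * E6 * B) := by
          refine mul_le_mul_of_nonneg_left (mul_le_mul_of_nonneg_right (mul_le_mul_of_nonneg_right
            (div_le_div_of_nonneg_left (by positivity) hMh0 hMhM) hE60) hB0) hLJα0
      _ ≤ LJ ^ (1 - α)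
          * ((((ℓ : ℝ) + 1) ^ 2 * EE * CP + 2 * ((ℓ : ℝ) + 1) ^ 2 * K₇ + 1) / Mh * E6 * B) := by
          refine mul_le_mul_of_nonneg_left (mul_le_mul_of_nonneg_right (mul_le_mul_of_nonneg_right
            (div_le_div_of_nonneg_right hQ1 hMh0.le) hE60) hB0) hLJα0
  · -- FAR PAIRS: two single columns
    have hns : nn ≤ s := by push Not at hnear; exact hnear.le
    have hsw := hfarW s hns
    calc s ^ (-α) * |((bX D a c hP cq hc)ᵀ *ᵥ g) x' - ((bX D a c hP cq hc)ᵀ *ᵥ g) x|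
        ≤ s ^ (-α) * (((ℓ : ℝ) + 1) * LJ * (K₇ / Mh * Real.exp (-(δ₇ / (d + 1) * dist0)) * B)
            + ((ℓ : ℝ) + 1) * LJ * (K₇ / Mh * Real.exp (-(δ₇ / (d + 1) * dist0)) * B)) :=
          mul_le_mul_of_nonneg_left ((abs_sub _ _).trans (add_le_add hcolx' hcolx)) hW0
      _ = (s ^ (-α) * (((ℓ : ℝ) + 1) * LJ)) * (2 * (K₇ / Mh) * Real.exp (-(δ₇ / (d + 1) * dist0)) * B) := by ring
      _ ≤ (((ℓ : ℝ) + 1) ^ 2 * LJ ^ (1 - α)) * (2 * (K₇ / Mh) * E6 * B) :=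
          mul_le_mul hsw (mul_le_mul_of_nonneg_right (mul_le_mul_of_nonneg_left hE7 (by positivity)) hB0)
            (by positivity) (by positivity)
      _ = LJ ^ (1 - α) * ((2 * ((ℓ : ℝ) + 1) ^ 2 * K₇) / Mh * E6 * B) := by ring
      _ ≤ LJ ^ (1 - α)
          * ((((ℓ : ℝ) + 1) ^ 2 * EE * CP + 2 * ((ℓ : ℝ) + 1) ^ 2 * K₇ + 1) / Mh * E6 * B) := by
          refine mul_le_mul_of_nonneg_left (mul_le_mul_of_nonneg_right (mul_le_mul_of_nonneg_right
            (div_le_div_of_nonneg_right hQ2 hMh0.le) hE60) hB0) hLJα0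

end ColPair

/-! ## §3 The pair-row bounds of `T₀ = D_α∘(G′₀ᵀ∂ᵀ)` and of `Ψ = D_α∘(RᵀΛ)`, rate uniform in `α` -/

section RowBounds

variable {ℓ Mh k R : ℕ} {P : Fin (d + 1) → ℕ}

/-- **THE PAIR ROWS OF `G′₀ᵀ∂ᵀ`, GENUINE `k`-LEVEL OPERATOR, RATE UNIFORM IN `α`** — p21's
`B6Prop22DualHolderMultiLevelBox.dualZero_rowBound` in the order `∃ δ ∀ α ∈ [0,1) ∃ A(α)`:
`|x̂−x|_∞^{−α}·|(G′₀ᵀ∂_μᵀλ)(x̂) − (G′₀ᵀ∂_μᵀλ)(x)| ≤ A·(L^{j})^{1−α}·e^{−δd(y,y′)/(d+1)}·|λ|` — the terms one by one (§1), at most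
`6·2^{d+1}` of them.  Proof = the original with the `∃`-witnesses reordered.
[cite: Balaban1984PropagatorsII, (2.64)–(2.67) p.234 (fifth entry, the G′₀ factor), (2.43) p.230] -/
theorem dualZero_rowBound_unif (d ℓ : ℕ) (hℓ : 1 ≤ ℓ) (aminus aplus a2minus a2plus : ℝ) (ha : 0 < aminus)
    (ha2 : 0 < a2minus) :
    ∃ δ : ℝ, 0 < δ ∧ ∀ (α : ℝ), 0 ≤ α → α < 1 → ∃ A : ℝ, 0 < A ∧ ∀ (k Mh R : ℕ), 3 ≤ Mh → 2 * (ℓ + 1) ≤ R →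
      ∀ (P : Fin (d + 1) → ℕ) (hP : ∀ μ, 1 ≤ P μ) (D : Domains d ℓ Mh k P R) (a c : ℕ → ℝ),
        (∀ i, 1 ≤ i → aminus ≤ a i ∧ a i ≤ aplus) → (∀ i, 1 ≤ i → a2minus ≤ c i ∧ c i ≤ a2plus) →
        ∀ (μ : Fin (d + 1)) (y' : ↥(bset D)) (lam : ↥(boxDom (N0 ℓ Mh k P)) → ℝ) (B : ℝ),
          BlockSupp (g := geom D) (blkOf D) lam y' B → ∀ p : BPair D,
          |dualOp D α ((gZeroML D a c hP)ᵀ * (dMat (N0 ℓ Mh k P) μ)ᵀ) lam p|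
            ≤ A * (((ℓ : ℝ) + 1) ^ (blkB D p).1.1) ^ (1 - α)
              * Real.exp (-(δ / (d + 1) * (geom D).dist (blkB D p) y')) * B := by
  obtain ⟨δ₅, hδ₅, hQA⟩ := aXt_dd_le_unif d ℓ hℓ aminus aplus a2minus a2plus ha ha2
  refine ⟨δ₅, hδ₅, fun α hα0 hα1 => ?_⟩
  obtain ⟨Q, hQ, hterm⟩ := hQA α hα0 hα1
  refine ⟨6 * 2 ^ (d + 1) * Q + 1, by positivity, ?_⟩
  intro k Mh R hMh hR P hP D a c haw hcw μ y' lam B hlam p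
  have hMh1 : 1 ≤ Mh := le_trans (by norm_num) hMh
  have hB0 : 0 ≤ B := hlam.nonneg
  have hlev : (blkB D p).1.1 = D.lev p.x.1 := rfl
  have hblkB : blkB D p = blkOf D p.x := rfl
  rw [hlev, hblkB]
  obtain ⟨E5, hE5⟩ : ∃ t : ℝ, t = Real.exp (-(δ₅ / (d + 1) * (geom D).dist (blkOf D p.x) y')) := ⟨_, rfl⟩
  obtain ⟨LJ, hLJ⟩ : ∃ t : ℝ, t = (((ℓ : ℝ) + 1) ^ D.lev p.x.1) ^ (1 - α) := ⟨_, rfl⟩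
  rw [← hE5, ← hLJ]
  have hE50 : 0 ≤ E5 := by rw [hE5]; exact (Real.exp_pos _).le
  have hLJ0 : 0 ≤ LJ := by rw [hLJ]; exact Real.rpow_nonneg (by positivity) _
  have hs0 : 0 < supNorm (p.x'.1 - p.x.1) :=
    lt_of_lt_of_le one_pos (B4StripSumsHolder.one_le_supNorm (sub_ne_zero.2 p.ne))
  have hW0 : 0 ≤ (supNorm (p.x'.1 - p.x.1)) ^ (-α) := Real.rpow_nonneg hs0.le _
  -- one term
  obtain ⟨E, hE⟩ : ∃ t : ℝ, t = LJ * (Q * E5 * B) := ⟨_, rfl⟩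
  have hEnn : 0 ≤ E := by rw [hE]; positivity
  have hone : ∀ (cq : ℕ × (Fin (d + 1) → ℤ)) (hc : CubeData D cq),
      |(supNorm (p.x'.1 - p.x.1)) ^ (-α)
        * ((((aX D a c hP cq hc)ᵀ * (dMat (N0 ℓ Mh k P) μ)ᵀ) *ᵥ lam) p.x'
          - (((aX D a c hP cq hc)ᵀ * (dMat (N0 ℓ Mh k P) μ)ᵀ) *ᵥ lam) p.x)| ≤ E := by
    intro cq hc
    rw [abs_mul, abs_of_nonneg hW0, hE, hLJ, hE5]
    exact hterm k Mh R hMh hR P hP D a c haw hcw μ y' lam B hlam p.x p.x' p.ne p.blk cq hc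
  -- the sum over the cover
  rw [dualOp_apply]
  unfold gZeroML
  rw [Matrix.transpose_sum, Finset.sum_mul, Matrix.sum_mulVec, Finset.sum_apply, Finset.sum_apply,
    ← Finset.sum_sub_distrib, Finset.mul_sum, Finset.attach_eq_univ]
  refine (Finset.abs_sum_le_sum_abs _ _).trans ?_
  obtain ⟨T, hTsub, hTcard⟩ : ∃ T : Finset (ℕ × (Fin (d + 1) → ℤ)),
      (∀ cq, cq ∈ keySet ℓ Mh (D.lev p.x.1) p.x.1 ∨ cq ∈ keySet ℓ Mh (D.lev p.x'.1) p.x'.1 → cq ∈ T)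
        ∧ (T.card : ℝ) ≤ 6 * 2 ^ (d + 1) := by
    refine ⟨keySet ℓ Mh (D.lev p.x.1) p.x.1 ∪ keySet ℓ Mh (D.lev p.x'.1) p.x'.1, fun cq h => ?_, ?_⟩
    · simp only [Finset.mem_union]; exact h
    · have h1 := card_keySet_le ℓ Mh (D.lev p.x.1) p.x.1
      have h2 := card_keySet_le ℓ Mh (D.lev p.x'.1) p.x'.1
      have u1 := Finset.card_union_le (keySet ℓ Mh (D.lev p.x.1) p.x.1) (keySet ℓ Mh (D.lev p.x'.1) p.x'.1)
      have h5 : (keySet ℓ Mh (D.lev p.x.1) p.x.1 ∪ keySet ℓ Mh (D.lev p.x'.1) p.x'.1).card ≤ 6 * 2 ^ (d + 1) := by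
        omega
      exact_mod_cast h5
  have key := sum_le_card_mul
    (fun cq : {cq // cq ∈ cubeSet D} => |(supNorm (p.x'.1 - p.x.1)) ^ (-α)
        * ((((aX D a c hP cq.1 (cubeData_of_mem cq.2))ᵀ * (dMat (N0 ℓ Mh k P) μ)ᵀ) *ᵥ lam) p.x'
          - (((aX D a c hP cq.1 (cubeData_of_mem cq.2))ᵀ * (dMat (N0 ℓ Mh k P) μ)ᵀ) *ᵥ lam) p.x)|)
    (fun cq => cq.1) Subtype.val_injective T
    (fun cq hq0 => by
      by_contra hmem
      apply hq0
      have hux : uX (ℓ := ℓ) (Mh := Mh) (k := k) (P := P) cq.1 p.x = 0 := by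
        by_contra h
        exact hmem (hTsub _ (Or.inl (mem_keySet_of_uX_ne_zero hℓ hR hP hMh1 cq.1 (cubeData_of_mem cq.2) h)))
      have hux' : uX (ℓ := ℓ) (Mh := Mh) (k := k) (P := P) cq.1 p.x' = 0 := by
        by_contra h
        exact hmem (hTsub _ (Or.inr (mem_keySet_of_uX_ne_zero hℓ hR hP hMh1 cq.1 (cubeData_of_mem cq.2) h)))
      rw [aXt_dMatt_mulVec hP cq.1 _ μ lam p.x, aXt_dMatt_mulVec hP cq.1 _ μ lam p.x',
        vX_eq_zero_of_uX cq.1 hux, vX_eq_zero_of_uX cq.1 hux']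
      simp only [zero_mul, sub_self, mul_zero, abs_zero])
    hEnn (fun cq => hone cq.1 (cubeData_of_mem cq.2))
  refine key.trans ?_
  calc (T.card : ℝ) * E ≤ 6 * 2 ^ (d + 1) * E := mul_le_mul_of_nonneg_right hTcard hEnn
    _ = 6 * 2 ^ (d + 1) * Q * LJ * E5 * B := by rw [hE]; ring
    _ ≤ (6 * 2 ^ (d + 1) * Q + 1) * LJ * E5 * B := by
        have : 0 ≤ LJ * E5 * B := by positivity
        nlinarith

/-- **THE PAIR ROWS OF `RᵀΛ` ARE `O(M_h^{−1})`, GENUINE `k`-LEVEL OPERATOR, RATE UNIFORM IN `α`** — p21's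
`B6Prop22DualHolderMultiLevelBox.dualPsi_rowBound` in the order `∃ δ ∀ α ∈ [0,1) ∃ A(α)`:
`|x̂−x|_∞^{−α}·|(RᵀΛf)(x̂) − (RᵀΛf)(x)| ≤ (A/M_h)·(L^{j})^{1−α}·e^{−δd(y,y′)/(d+1)}·sup|f|` — the terms one by one (§2), at most
`6·2^{d+1}` of them.  Proof = the original with the `∃`-witnesses reordered.
[cite: Balaban1984PropagatorsII, (2.44) p.230, (2.49)/(2.51) p.232, (2.64)–(2.67) p.234 (fifth entry)] -/
theorem dualPsi_rowBound_unif (d ℓ : ℕ) (hℓ : 1 ≤ ℓ) (aminus aplus a2minus a2plus : ℝ) (ha : 0 < aminus)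
    (ha2 : 0 < a2minus) :
    ∃ δ : ℝ, 0 < δ ∧ ∀ (α : ℝ), 0 ≤ α → α < 1 → ∃ A : ℝ, 0 < A ∧ ∀ (k Mh R : ℕ), 3 ≤ Mh → 2 * (ℓ + 1) ≤ R →
      ∀ (P : Fin (d + 1) → ℕ) (hP : ∀ μ, 1 ≤ P μ) (D : Domains d ℓ Mh k P R) (a c : ℕ → ℝ),
        (∀ i, 1 ≤ i → aminus ≤ a i ∧ a i ≤ aplus) → (∀ i, 1 ≤ i → a2minus ≤ c i ∧ c i ≤ a2plus) →
        ∀ (y' : ↥(bset D)) (lam : ↥(boxDom (N0 ℓ Mh k P)) → ℝ) (B : ℝ),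
          BlockSupp (g := geom D) (blkOf D) lam y' B → ∀ p : BPair D,
          |dualOp D α ((rML D a c hP)ᵀ * levW D 1) lam p|
            ≤ A / Mh * (((ℓ : ℝ) + 1) ^ (blkB D p).1.1) ^ (1 - α)
              * Real.exp (-(δ / (d + 1) * (geom D).dist (blkB D p) y')) * B := by
  obtain ⟨δ₆, hδ₆, hQA⟩ := bXt_dd_le_unif d ℓ hℓ aminus aplus a2minus a2plus ha ha2
  refine ⟨δ₆, hδ₆, fun α hα0 hα1 => ?_⟩
  obtain ⟨Q, hQ, hterm⟩ := hQA α hα0 hα1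
  refine ⟨6 * 2 ^ (d + 1) * Q + 1, by positivity, ?_⟩
  intro k Mh R hMh hR P hP D a c haw hcw y' lam B hlam p
  have hMh1 : 1 ≤ Mh := le_trans (by norm_num) hMh
  have hMhr : (1 : ℝ) ≤ Mh := by exact_mod_cast hMh1
  have hMh0 : (0 : ℝ) < Mh := by linarith
  have hB0 : 0 ≤ B := hlam.nonneg
  have hlev : (blkB D p).1.1 = D.lev p.x.1 := rfl
  have hblkB : blkB D p = blkOf D p.x := rfl
  rw [hlev, hblkB]
  obtain ⟨E6, hE6⟩ : ∃ t : ℝ, t = Real.exp (-(δ₆ / (d + 1) * (geom D).dist (blkOf D p.x) y')) := ⟨_, rfl⟩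
  obtain ⟨LJ, hLJ⟩ : ∃ t : ℝ, t = (((ℓ : ℝ) + 1) ^ D.lev p.x.1) ^ (1 - α) := ⟨_, rfl⟩
  rw [← hE6, ← hLJ]
  have hE60 : 0 ≤ E6 := by rw [hE6]; exact (Real.exp_pos _).le
  have hLJ0 : 0 ≤ LJ := by rw [hLJ]; exact Real.rpow_nonneg (by positivity) _
  have hs0 : 0 < supNorm (p.x'.1 - p.x.1) :=
    lt_of_lt_of_le one_pos (B4StripSumsHolder.one_le_supNorm (sub_ne_zero.2 p.ne))
  have hW0 : 0 ≤ (supNorm (p.x'.1 - p.x.1)) ^ (-α) := Real.rpow_nonneg hs0.le _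
  obtain ⟨g, hgdef⟩ : ∃ t : ↥(boxDom (N0 ℓ Mh k P)) → ℝ, t = levW D 1 *ᵥ lam := ⟨_, rfl⟩
  -- one term
  obtain ⟨E, hE⟩ : ∃ t : ℝ, t = LJ * (Q / Mh * E6 * B) := ⟨_, rfl⟩
  have hEnn : 0 ≤ E := by rw [hE]; positivity
  have hone : ∀ (cq : ℕ × (Fin (d + 1) → ℤ)) (hc : CubeData D cq),
      |(supNorm (p.x'.1 - p.x.1)) ^ (-α)
        * (((bX D a c hP cq hc)ᵀ *ᵥ g) p.x' - ((bX D a c hP cq hc)ᵀ *ᵥ g) p.x)| ≤ E := by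
    intro cq hc
    rw [abs_mul, abs_of_nonneg hW0, hE, hLJ, hE6, hgdef]
    exact hterm k Mh R hMh hR P hP D a c haw hcw y' lam B hlam p.x p.x' p.ne p.blk cq hc
  -- the sum over the cover
  rw [dualOp_apply, ← Matrix.mulVec_mulVec, ← hgdef]
  unfold rML
  rw [Matrix.transpose_sum, Matrix.sum_mulVec, Finset.sum_apply, Finset.sum_apply, ← Finset.sum_sub_distrib,
    Finset.mul_sum, Finset.attach_eq_univ]
  refine (Finset.abs_sum_le_sum_abs _ _).trans ?_
  obtain ⟨T, hTsub, hTcard⟩ : ∃ T : Finset (ℕ × (Fin (d + 1) → ℤ)),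
      (∀ cq, cq ∈ keySet ℓ Mh (D.lev p.x.1) p.x.1 ∨ cq ∈ keySet ℓ Mh (D.lev p.x'.1) p.x'.1 → cq ∈ T)
        ∧ (T.card : ℝ) ≤ 6 * 2 ^ (d + 1) := by
    refine ⟨keySet ℓ Mh (D.lev p.x.1) p.x.1 ∪ keySet ℓ Mh (D.lev p.x'.1) p.x'.1, fun cq h => ?_, ?_⟩
    · simp only [Finset.mem_union]; exact h
    · have h1 := card_keySet_le ℓ Mh (D.lev p.x.1) p.x.1
      have h2 := card_keySet_le ℓ Mh (D.lev p.x'.1) p.x'.1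
      have u1 := Finset.card_union_le (keySet ℓ Mh (D.lev p.x.1) p.x.1) (keySet ℓ Mh (D.lev p.x'.1) p.x'.1)
      have h5 : (keySet ℓ Mh (D.lev p.x.1) p.x.1 ∪ keySet ℓ Mh (D.lev p.x'.1) p.x'.1).card ≤ 6 * 2 ^ (d + 1) := by
        omega
      exact_mod_cast h5
  have key := sum_le_card_mul
    (fun cq : {cq // cq ∈ cubeSet D} => |(supNorm (p.x'.1 - p.x.1)) ^ (-α)
        * (((bX D a c hP cq.1 (cubeData_of_mem cq.2))ᵀ *ᵥ g) p.x' - ((bX D a c hP cq.1 (cubeData_of_mem cq.2))ᵀ *ᵥ g) p.x)|)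
    (fun cq => cq.1) Subtype.val_injective T
    (fun cq hq0 => by
      by_contra hmem
      apply hq0
      have hux : uX (ℓ := ℓ) (Mh := Mh) (k := k) (P := P) cq.1 p.x = 0 := by
        by_contra h
        exact hmem (hTsub _ (Or.inl (mem_keySet_of_uX_ne_zero hℓ hR hP hMh1 cq.1 (cubeData_of_mem cq.2) h)))
      have hux' : uX (ℓ := ℓ) (Mh := Mh) (k := k) (P := P) cq.1 p.x' = 0 := by
        by_contra h
        exact hmem (hTsub _ (Or.inr (mem_keySet_of_uX_ne_zero hℓ hR hP hMh1 cq.1 (cubeData_of_mem cq.2) h)))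
      rw [bXt_col_eq_zero_of_uX (D := D) (a := a) (c := c) hP cq.1 _ g hux,
        bXt_col_eq_zero_of_uX (D := D) (a := a) (c := c) hP cq.1 _ g hux']
      simp only [sub_self, mul_zero, abs_zero])
    hEnn (fun cq => hone cq.1 (cubeData_of_mem cq.2))
  refine key.trans ?_
  calc (T.card : ℝ) * E ≤ 6 * 2 ^ (d + 1) * E := mul_le_mul_of_nonneg_right hTcard hEnn
    _ = (6 * 2 ^ (d + 1) * Q) / Mh * LJ * E6 * B := by rw [hE]; ring
    _ ≤ (6 * 2 ^ (d + 1) * Q + 1) / Mh * LJ * E6 * B := by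
        have : 0 ≤ LJ * E6 * B := by positivity
        have h1 : (6 * 2 ^ (d + 1) * Q) / Mh ≤ (6 * 2 ^ (d + 1) * Q + 1) / Mh :=
          div_le_div_of_nonneg_right (by linarith) hMh0.le
        calc (6 * 2 ^ (d + 1) * Q) / Mh * LJ * E6 * B = (6 * 2 ^ (d + 1) * Q) / Mh * (LJ * E6 * B) := by ring
          _ ≤ (6 * 2 ^ (d + 1) * Q + 1) / Mh * (LJ * E6 * B) := mul_le_mul_of_nonneg_right h1 this
          _ = _ := by ring

end RowBounds

/-! ## §4 Proposition 2.2, fifth entry, for the genuine `k`-level operator — one rate, one threshold for all `α` -/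

section Prop22

variable {ℓ Mh k R : ℕ} {P : Fin (d + 1) → ℕ}

/-- **THE LIFTED FIFTH ENTRY HAS A MAJORANT** `C(α)·(L^{j})^{1−α}·e^{−½δ₀d(y,y′)}` on `𝔅`, WITH `δ₀` AND THE THRESHOLDS
`M₀`, `N₀` THE SAME FOR ALL `α ∈ [0,1)` — p21's `B6Prop22DualHolderMultiLevelBox.hasMajorant_dualHolder_multiLevelBox` in
print's order `∃ δ₀ M₀ N₀ ∀ α ∃ C(α)`: the rate `δ₀ = min(δ_V/2, min(δ_Z, δ_Ψ)/(d+1))` (third entry, §3), the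
(2.59)-threshold `N₀(δ₀, N₀^V)`, the (2.61)-constant `c_K(N₀, δ₀)` and «M sufficiently large» `M₀ = M₀^V` (the third
entry's) are all `α`-free; only `C = A_Z(α) + A_Ψ(α)·C_V·c_K + 1` depends on `α`.  Proof = the original (lifted identity
`T = T₀ + Ψ·Ṽ`, no iteration; left convolution; Lemma 2.1 on the box) with the `∃`-witnesses reordered.
[cite: Balaban1984PropagatorsII, Proposition 2.2 (2.67) p.234 (fifth entry), (2.64)–(2.66) p.234] -/
theorem hasMajorant_dualHolder_multiLevelBox_unif (d ℓ : ℕ) (hℓ : 1 ≤ ℓ) (aminus aplus a2minus a2plus : ℝ)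
    (ha : 0 < aminus) (ha2 : 0 < a2minus) :
    ∃ δ₀ M₀ : ℝ, ∃ N₀ : ℕ, 0 < δ₀ ∧ 0 < M₀ ∧ 0 < N₀ ∧ ∀ (α : ℝ), 0 ≤ α → α < 1 → ∃ C : ℝ, 0 < C ∧
      ∀ (k Mh R : ℕ), 3 ≤ Mh → M₀ ≤ ((ℓ : ℝ) + 1) * Mh → 2 * (ℓ + 1) ≤ R → N₀ + 1 ≤ R * ((ℓ + 1) * Mh) →
      ∀ (P : Fin (d + 1) → ℕ) (hP : ∀ μ, 1 ≤ P μ) (D : Domains d ℓ Mh k P R) (a c : ℕ → ℝ),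
        (∀ i, 1 ≤ i → aminus ≤ a i ∧ a i ≤ aplus) → (∀ i, 1 ≤ i → a2minus ≤ c i ∧ c i ≤ a2plus) →
        (∀ i, 1 ≤ i → a (i + 1) = aNext ℓ (a i) (c i)) → ∀ μ : Fin (d + 1),
        HasMajorant (g := geom D) (Sum.elim (blkB D) (blkOf D))
          (liftL (dualOp D α (gml (N0 ℓ Mh k P) ℓ k D.lev a * (dMat (N0 ℓ Mh k P) μ)ᵀ)))
          (fun y y' => C * (((ℓ : ℝ) + 1) ^ y.1.1) ^ (1 - α) * Real.exp (-(δ₀ / 2 * (geom D).dist y y'))) := by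
  obtain ⟨δV, CV, M₀V, N₀V, hδV, hCV, hM₀V, hN₀V, hV⟩ :=
    prop22_third_multiLevelBox d ℓ hℓ aminus aplus a2minus a2plus ha ha2
  obtain ⟨δZ, hδZ, hZA⟩ := dualZero_rowBound_unif d ℓ hℓ aminus aplus a2minus a2plus ha ha2
  obtain ⟨δΨ, hδΨ, hΨA⟩ := dualPsi_rowBound_unif d ℓ hℓ aminus aplus a2minus a2plus ha ha2
  have hL0 : (0 : ℝ) < (ℓ : ℝ) + 1 := by positivity
  have hL1 : (1 : ℝ) ≤ (ℓ : ℝ) + 1 := by linarith [(Nat.cast_nonneg ℓ : (0 : ℝ) ≤ ℓ)]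
  -- the common rate
  set δ₀ : ℝ := min (δV / 2) (min δZ δΨ / (d + 1)) with hδ₀
  have hδ₀pos : 0 < δ₀ := by rw [hδ₀]; exact lt_min (half_pos hδV) (div_pos (lt_min hδZ hδΨ) (by positivity))
  have hδ₀V : δ₀ ≤ δV / 2 := by rw [hδ₀]; exact min_le_left _ _
  have hδ₀Z : δ₀ ≤ δZ / (d + 1) := by
    rw [hδ₀]; exact (min_le_right _ _).trans (div_le_div_of_nonneg_right (min_le_left _ _) (by positivity))
  have hδ₀Ψ : δ₀ ≤ δΨ / (d + 1) := by
    rw [hδ₀]; exact (min_le_right _ _).trans (div_le_div_of_nonneg_right (min_le_right _ _) (by positivity))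
  -- the (2.59)-threshold (ours and the third entry's)
  set N₀ : ℕ := ⌈4 * ((d : ℝ) + 1) * ((ℓ : ℝ) + 1) / (1 / 2 * δ₀)⌉₊ + 1 + N₀V with hN₀
  have hN₀pos : 0 < N₀ := by rw [hN₀]; omega
  have hθlt : Real.exp (-(1 / 2 * δ₀)) * ((ℓ : ℝ) + 1) ^ ((2 * (d + 1 : ℕ) : ℝ) / N₀) < 1 := by
    refine theta_lt_one_of_log hL0 hN₀pos ?_
    have hlog : Real.log ((ℓ : ℝ) + 1) ≤ (ℓ : ℝ) + 1 := (Real.log_le_sub_one_of_pos hL0).trans (by linarith)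
    have hN₀ge : 4 * ((d : ℝ) + 1) * ((ℓ : ℝ) + 1) / (1 / 2 * δ₀) < (N₀ : ℝ) := by
      rw [hN₀]; push_cast
      have h0 : (0 : ℝ) ≤ (N₀V : ℝ) := Nat.cast_nonneg _
      exact lt_of_le_of_lt (Nat.le_ceil _) (by linarith)
    have hσ : (0 : ℝ) < 1 / 2 * δ₀ := by positivity
    rw [div_lt_iff₀ hσ] at hN₀ge
    push_cast
    nlinarith [mul_nonneg (by positivity : (0 : ℝ) ≤ 2 * ((d : ℝ) + 1)) (Real.log_nonneg hL1)]
  set cK : ℝ := K261 N₀ (d + 1) ((ℓ : ℝ) + 1) 1 (1 / 2 * δ₀) with hcK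
  have hcK0 : 0 ≤ cK := K261_nonneg (by positivity) zero_le_one
  refine ⟨δ₀, M₀V, N₀, hδ₀pos, hM₀V, hN₀pos, fun α hα0 hα1 => ?_⟩
  obtain ⟨AZ, hAZ, hZ⟩ := hZA α hα0 hα1
  obtain ⟨AΨ, hAΨ, hΨ⟩ := hΨA α hα0 hα1
  refine ⟨AZ + AΨ * CV * cK + 1, by positivity, ?_⟩
  intro k Mh R hMh hM hR hRM P hP D a c haw hcw hac μ
  have hMh1 : 1 ≤ Mh := le_trans (by norm_num) hMh
  have hMhr : (1 : ℝ) ≤ Mh := by exact_mod_cast hMh1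
  have hMh0 : (0 : ℝ) < Mh := by linarith
  have hRMV : N₀V + 1 ≤ R * ((ℓ + 1) * Mh) := le_trans (by rw [hN₀]; omega) hRM
  have hapos : ∀ j, 1 ≤ j → 0 < a j := fun j hj => lt_of_lt_of_le ha (haw j hj).1
  have hcpos : ∀ j, 1 ≤ j → 0 < c j := fun j hj => lt_of_lt_of_le ha2 (hcw j hj).1
  -- geometry of the box
  obtain ⟨-, h261, -, -⟩ := lemma21_box D hMh1 hP hN₀pos hRM hδ₀pos.le (α := 1 / 2) (by norm_num)
    (by norm_num) hθlt
  obtain ⟨htri, hrefl, hdnn⟩ := triangle_refl_nonneg D hMh1 hP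
  have hsymm : ∀ a b : (geom D).Site, (geom D).dist a b = (geom D).dist b a := fun a b => by
    show (((bond D).dist a b : ℕ) : ℝ) = (((bond D).dist b a : ℕ) : ℝ)
    rw [SimpleGraph.dist_comm]
  have hαδ : (0 : ℝ) ≤ (1 - 1 / 2) * δ₀ := by nlinarith [hδ₀pos.le]
  -- the majorant of `Ṽ = Λ^{−1}G′∂ᵀ` (third entry, conjugated), lifted
  have hVmaj := hV k Mh R hMh hM hR hRMV P hP D a c haw hcw hac μ
  have hVt : HasMajorant (g := geom D) (blkOf D)
      (Matrix.toLin' (levW D (-1) * (gml (N0 ℓ Mh k P) ℓ k D.lev a * (dMat (N0 ℓ Mh k P) μ)ᵀ)))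
      (fun y y' => CV * Real.exp (-(δ₀ * (geom D).dist y y'))) := by
    rw [levW_neg_one_eq]
    refine hasMajorant_mono (g := geom D) (blkOf D)
      (hasMajorant_diagonal_mul (g := geom D) (blkOf D) (fun y : ↥(bset D) => (((ℓ : ℝ) + 1) ^ y.1.1)⁻¹)
        (fun y => by positivity) _ hVmaj) fun y y' => ?_
    have hLy : (0 : ℝ) < ((ℓ : ℝ) + 1) ^ y.1.1 := by positivity
    have hexp : Real.exp (-(δV / 2 * (geom D).dist y y')) ≤ Real.exp (-(δ₀ * (geom D).dist y y')) :=
      Real.exp_le_exp.2 (by nlinarith [hdnn y y', hδ₀V])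
    calc (((ℓ : ℝ) + 1) ^ y.1.1)⁻¹ * (CV * ((ℓ : ℝ) + 1) ^ y.1.1 * Real.exp (-(δV / 2 * (geom D).dist y y')))
        = CV * Real.exp (-(δV / 2 * (geom D).dist y y')) := by field_simp
      _ ≤ CV * Real.exp (-(δ₀ * (geom D).dist y y')) := mul_le_mul_of_nonneg_left hexp hCV.le
  have hVlift := hasMajorant_liftR (g := geom D) (blkOf D) (blkB D)
    (K := fun y y' => CV * Real.exp (-(δ₀ * (geom D).dist y y'))) (fun y y' => by positivity) hVt
  -- the majorants of the lifted `Ψ` and `T₀` (pair rows, §2)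
  have hΨm : HasMajorant (g := geom D) (Sum.elim (blkB D) (blkOf D))
      (liftL (dualOp D α ((rML D a c hP)ᵀ * levW D 1)))
      (fun y y' => AΨ / Mh * (((ℓ : ℝ) + 1) ^ y.1.1) ^ (1 - α)
        * Real.exp (-((1 - 1 / 2) * δ₀ * (geom D).dist y y'))) := by
    refine hasMajorant_liftL (g := geom D) (blkOf D) (blkB D)
      (K := fun y y' => AΨ / Mh * (((ℓ : ℝ) + 1) ^ y.1.1) ^ (1 - α)
        * Real.exp (-((1 - 1 / 2) * δ₀ * (geom D).dist y y')))
      (fun y y' => by positivity) fun y' lam B hlam p => ?_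
    refine (hΨ k Mh R hMh hR P hP D a c haw hcw y' lam B hlam p).trans ?_
    refine mul_le_mul_of_nonneg_right (mul_le_mul_of_nonneg_left (Real.exp_le_exp.2 ?_) (by positivity)) hlam.nonneg
    have h1 : (1 - 1 / 2) * δ₀ ≤ δΨ / (d + 1) := by linarith
    nlinarith [hdnn (blkB D p) y', h1]
  have hZm : HasMajorant (g := geom D) (Sum.elim (blkB D) (blkOf D))
      (liftL (dualOp D α ((gZeroML D a c hP)ᵀ * (dMat (N0 ℓ Mh k P) μ)ᵀ)))
      (fun y y' => AZ * (((ℓ : ℝ) + 1) ^ y.1.1) ^ (1 - α)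
        * Real.exp (-((1 - 1 / 2) * δ₀ * (geom D).dist y y'))) := by
    refine hasMajorant_liftL (g := geom D) (blkOf D) (blkB D)
      (K := fun y y' => AZ * (((ℓ : ℝ) + 1) ^ y.1.1) ^ (1 - α)
        * Real.exp (-((1 - 1 / 2) * δ₀ * (geom D).dist y y')))
      (fun y y' => by positivity) fun y' lam B hlam p => ?_
    refine (hZ k Mh R hMh hR P hP D a c haw hcw μ y' lam B hlam p).trans ?_
    refine mul_le_mul_of_nonneg_right (mul_le_mul_of_nonneg_left (Real.exp_le_exp.2 ?_) (by positivity)) hlam.nonneg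
    have h1 : (1 - 1 / 2) * δ₀ ≤ δZ / (d + 1) := by linarith
    nlinarith [hdnn (blkB D p) y', h1]
  -- the product `Ψ·Ṽ` and the left convolution
  have hprod := hasMajorant_mul (g := geom D) (Sum.elim (blkB D) (blkOf D))
    (K₂ := fun y y' => CV * Real.exp (-(δ₀ * (geom D).dist y y'))) hΨm hVlift
    (fun y y' => mul_nonneg hCV.le (Real.exp_pos _).le)
  have hprod' : HasMajorant (g := geom D) (Sum.elim (blkB D) (blkOf D))
      (liftL (dualOp D α ((rML D a c hP)ᵀ * levW D 1))
        * liftR (Matrix.toLin' (levW D (-1) * (gml (N0 ℓ Mh k P) ℓ k D.lev a * (dMat (N0 ℓ Mh k P) μ)ᵀ))))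
      (fun y y' => AΨ / Mh * (((ℓ : ℝ) + 1) ^ y.1.1) ^ (1 - α) * CV * cK
        * Real.exp (-((1 - 1 / 2) * δ₀ * (geom D).dist y y'))) :=
    hasMajorant_mono (g := geom D) (Sum.elim (blkB D) (blkOf D)) hprod fun y y' =>
      conv_left_le hαδ htri hsymm h261 (r := AΨ / Mh * (((ℓ : ℝ) + 1) ^ y.1.1) ^ (1 - α)) (A := CV)
        (by positivity) hCV.le y y'
  -- the lifted identity and the sum
  rw [dual_identity D (c := c) hℓ hR hP hMh1 hapos hcpos hac α ((dMat (N0 ℓ Mh k P) μ)ᵀ)]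
  have hsum := hasMajorant_add (g := geom D) (Sum.elim (blkB D) (blkOf D)) hZm hprod'
  refine hasMajorant_mono (g := geom D) (Sum.elim (blkB D) (blkOf D)) hsum fun y y' => ?_
  have he : Real.exp (-((1 - 1 / 2) * δ₀ * (geom D).dist y y')) = Real.exp (-(δ₀ / 2 * (geom D).dist y y')) := by
    congr 1; ring
  rw [he]
  have hP0 : 0 ≤ (((ℓ : ℝ) + 1) ^ y.1.1) ^ (1 - α) := Real.rpow_nonneg (by positivity) _
  have he0 : 0 ≤ Real.exp (-(δ₀ / 2 * (geom D).dist y y')) := (Real.exp_pos _).le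
  have h1 : AΨ / Mh ≤ AΨ := div_le_self hAΨ.le hMhr
  have h2 : AΨ / Mh * (CV * cK) ≤ AΨ * (CV * cK) := mul_le_mul_of_nonneg_right h1 (mul_nonneg hCV.le hcK0)
  calc AZ * (((ℓ : ℝ) + 1) ^ y.1.1) ^ (1 - α) * Real.exp (-(δ₀ / 2 * (geom D).dist y y'))
        + AΨ / Mh * (((ℓ : ℝ) + 1) ^ y.1.1) ^ (1 - α) * CV * cK * Real.exp (-(δ₀ / 2 * (geom D).dist y y'))
      = (AZ + AΨ / Mh * (CV * cK)) * ((((ℓ : ℝ) + 1) ^ y.1.1) ^ (1 - α) * Real.exp (-(δ₀ / 2 * (geom D).dist y y'))) := by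
        ring
    _ ≤ (AZ + AΨ * CV * cK + 1) * ((((ℓ : ℝ) + 1) ^ y.1.1) ^ (1 - α) * Real.exp (-(δ₀ / 2 * (geom D).dist y y'))) :=
        mul_le_mul_of_nonneg_right (by linarith) (mul_nonneg hP0 he0)
    _ = (AZ + AΨ * CV * cK + 1) * (((ℓ : ℝ) + 1) ^ y.1.1) ^ (1 - α) * Real.exp (-(δ₀ / 2 * (geom D).dist y y')) := by
        ring

/-- **[B6] PROPOSITION 2.2, FIFTH ENTRY OF (2.67) (`‖ζG′∇^{η*}λ‖_α`), FOR THE GENUINE `k`-LEVEL OPERATOR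
`G′ = Δ′_a^{−1}` ON A BOX, IN THE PRINTED QUANTIFIER ORDER**: there are `δ₀, M₀ > 0` and `N₀ ≥ 1` (functions of `d`,
`ℓ`, the windows) such that for every `0 ≤ α < 1` there is `C = C(α) > 0` with: for EVERY number of levels `k`,
`M_h ≥ 3` with `L·M_h ≥ M₀` («M is sufficiently large»), `R ≥ 2L` with `RM ≥ N₀ + 1` ((2.59)), volume `P`, nested
family `D` of domains (2.1)–(2.2), weights `a_i ∈ [a₋, a₊]`, `c_i ∈ [c₋, c₊]` with `a_{i+1} = aNext ℓ a_i c_i`, axis `μ`,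
and all `x ≠ x̂` of one block `B^j(y)`:
`|x̂−x|_∞^{−α}·|(G′∂_μᵀλ)(x̂) − (G′∂_μᵀλ)(x)| ≤ C·(L^{j})^{1−α}·e^{−½δ₀d(y,y′)}·|λ|`, `supp λ ⊂ B^{j′}(y′)` (lattice units, as
in the original `prop22_fifth_multiLevelBox`; «δ₀» of print does not depend on `α`, [3] p. 573 «δ₀ … depending on d, M
only, c₀ on α also»).
[cite: Balaban1984PropagatorsII, Proposition 2.2 (2.67) p.234 (fifth entry «(L^jη)^{1−α}(‖ζ‖_α + |ζ|)»), (2.64)–(2.66) p.234; Balaban1983RegularityDecay, Theorem (1.9) p.573] -/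
theorem prop22_fifth_multiLevelBox_unif (d ℓ : ℕ) (hℓ : 1 ≤ ℓ) (aminus aplus a2minus a2plus : ℝ) (ha : 0 < aminus)
    (ha2 : 0 < a2minus) :
    ∃ δ₀ M₀ : ℝ, ∃ N₀ : ℕ, 0 < δ₀ ∧ 0 < M₀ ∧ 0 < N₀ ∧ ∀ (α : ℝ), 0 ≤ α → α < 1 → ∃ C : ℝ, 0 < C ∧
      ∀ (k Mh R : ℕ), 3 ≤ Mh → M₀ ≤ ((ℓ : ℝ) + 1) * Mh → 2 * (ℓ + 1) ≤ R → N₀ + 1 ≤ R * ((ℓ + 1) * Mh) →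
      ∀ (P : Fin (d + 1) → ℕ) (hP : ∀ μ, 1 ≤ P μ) (D : Domains d ℓ Mh k P R) (a c : ℕ → ℝ),
        (∀ i, 1 ≤ i → aminus ≤ a i ∧ a i ≤ aplus) → (∀ i, 1 ≤ i → a2minus ≤ c i ∧ c i ≤ a2plus) →
        (∀ i, 1 ≤ i → a (i + 1) = aNext ℓ (a i) (c i)) →
        ∀ (μ : Fin (d + 1)) (y' : ↥(bset D)) (lam : ↥(boxDom (N0 ℓ Mh k P)) → ℝ) (B : ℝ),
          BlockSupp (g := geom D) (blkOf D) lam y' B →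
          ∀ (x x' : ↥(boxDom (N0 ℓ Mh k P))), x'.1 ≠ x.1 → blkOf D x' = blkOf D x →
            (supNorm (x'.1 - x.1)) ^ (-α)
                * |((gml (N0 ℓ Mh k P) ℓ k D.lev a * (dMat (N0 ℓ Mh k P) μ)ᵀ) *ᵥ lam) x'
                    - ((gml (N0 ℓ Mh k P) ℓ k D.lev a * (dMat (N0 ℓ Mh k P) μ)ᵀ) *ᵥ lam) x|
              ≤ C * (((ℓ : ℝ) + 1) ^ D.lev x.1) ^ (1 - α) * Real.exp (-(δ₀ / 2 * (geom D).dist (blkOf D x) y')) * B := by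
  obtain ⟨δ₀, M₀, N₀, hδ₀, hM₀, hN₀, hCA⟩ :=
    hasMajorant_dualHolder_multiLevelBox_unif d ℓ hℓ aminus aplus a2minus a2plus ha ha2
  refine ⟨δ₀, M₀, N₀, hδ₀, hM₀, hN₀, fun α hα0 hα1 => ?_⟩
  obtain ⟨C, hC, h⟩ := hCA α hα0 hα1
  refine ⟨C, hC, ?_⟩
  intro k Mh R hMh hM hR hRM P hP D a c haw hcw hac μ y' lam B hlam x x' hne hblk
  have hmaj := h k Mh R hMh hM hR hRM P hP D a c haw hcw hac μ
  have hrow := rowBound_of_hasMajorant_liftL (g := geom D) (blkOf D) (blkB D) hmaj y' lam B hlam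
    (⟨x, x', hne, hblk⟩ : BPair D)
  rw [dualOp_apply, abs_mul, abs_of_nonneg (Real.rpow_nonneg (supNorm_nonneg _) _)] at hrow
  exact hrow

end Prop22

end

end Literature.MathematicalPhysics.QuantumFieldTheory.Balaban1983to89.B6Prop22DualHolderMultiLevelBoxRateUnif
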